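import Literature.MathematicalPhysics.QuantumFieldTheory.Balaban1983to89.B5G183Rate
import Literature.MathematicalPhysics.QuantumFieldTheory.Balaban1983to89.B5Hk163RateSum

/-!
# Bałaban [CMP 95 (1984)] (1.83) at `U = 1`: the ALIAS SUMS of the finite-rank part of the fibre of
`G = Δ_a⁻¹` — uniform entrywise `ℓ¹` bounds and the **η-RATE `O(1/N)` of the summed finite-rank part**,
paired and unpaired alias classes (linear theory, explicit constants, no conditionals)
(v1.0.1, DOCSTRING-ONLY: the exponential-decay locator in NOT-CLAIMED (iv) is Prop. 1.2 (1.110)–(1.111)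
p. 35 (render ref1 p019 read as image; XREAD journal l.52371 item R2), not Prop. 1.1 p. 33; no declaration changed.)

HONEST FRAMING (cell `pub-balaban`, T⁴ programme, estimate NE2 = U1a «η-rate, linear theory»).  This module
is about ONE explicit finite-dimensional object: the fibre matrix, at a fixed reduced momentum `p′ ≠ 0`, of
Bałaban's momentum representation (1.83) of `G = Δ_a⁻¹` ([Balaban1984PropagatorsI] p. 31) for the TRIVIAL
background `U = 1` on a FINITE torus with `η = 1/n`, in the physical variables and with the majorants of the
sibling module `B5G183Rate` (which types every ENTRY of (1.83) and its η-rate).  Here the entries are SUMMED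
over the alias classes `l, l′ ∈ (ℤ/n)^d`.  Nothing here is infinite-volume, nothing is a mass gap, nothing is
uniform in a coupling, and nothing in this file is progress on any Clay problem or on the summit statement
of this programme; it is elementary real analysis (finite sums, King's alias-sum bound) with OUR constants.
All theorems are tagged `[folklore]`: the mechanism is King's [King1986] §4, p. 672 — bound the `m ≠ 0`
(unpaired) aliases by the convergent alias sum (4.22) with a spare negative power of momentum, and for
`m = 0` «we successively replace each factor by the corresponding one … and bound the error» —, the
object is Bałaban's (1.83); the packaging, the split of the zone centre, and every constant are ours and
are NOT attributed to either author.  `[cite: …]` tags locate TEXT, never a proof.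

WHAT IS PRINTED (renders read by this seat: [Balaban1984PropagatorsI] pp. 31–32; [King1986] p. 672).
Bałaban p. 31, (1.83): the fibre of `G` at `p′` in the index `(l, μ)` is
`δ_{μν}[δ_{ll′}/Δ(p′+l) − a·conj(u v_μ)(p′+l)·φ_μ⁻¹(p′)·(u v_μ)(p′+l′)/(Δ(p′+l)Δ(p′+l′))]`
`  + b(l,μ)·a⁻¹(Σ_λ|∂_{1,λ}(p′)|²/φ_λ(p′))⁻¹·conj b(l′,ν)` (the three terms: FREE DIAGONAL, X-BLOCK,
RANK-ONE BLOCK).  p. 32: «We will prove that G is a bounded operator by transforming the formula (1.83) in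
a manner similar to that applied in the formula (1.63) for the operator H_k.» … (after (1.87)) «Using all
the properties of the functions appearing above, e.g. the inequality (1.36), we can easily prove that this
expression defines a bounded operator on L²(T_η). It is bounded also when differentiated two times at
most.» … (after (1.88)) «Thus the third term is well defined by continuity at p′ = 0 and defines a bounded
operator together with its derivatives up to the second».  King p. 672: «where `l ∈ 2πZ^d` is the same as
in (4.2). Also `m ∈ 2πL^kZ^d` and `|m_μ| ≤ πL^k(L^n − 1)` for L odd»; (4.20)
`|u^{η′}_{k+n}(p′+l+m)| < CΠ_{μ=1}^{d}|p′_μ||(p′+l+m)_μ|⁻¹`; (4.21)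
`|Δ^{(k+n)}(p′)Δ^{η′}(p′+l+m)⁻¹| ≤ C|p′|²|p′+l+m|⁻²`; «so the sum over l, m is bounded by
(4.22) `Σ_{l,m}|p′+l+m|^{α−1}Π_μ|(p′+l+m)_μ|⁻¹ ≤ C` for `α < 1`.»; «We first bound the terms in (4.19) with
`m ≠ 0` as follows: … `≤ CL^{−γk}` for `α + γ < 1`.» (4.23); «To analyze the `m = 0` term in (4.19), we
successively replace each factor by the corresponding one in the expression for (∂_α(x,y)∂^η_μ a_kG^η_kQ_k^*)(z)
and bound the error. We must always be careful to keep enough negative powers of momentum so that» (the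
sums converge, p. 673).

WHAT IS TYPED HERE (all at `m² = 0`, `U = 1`, levels `N ≥ 1` and `RN`, `R ≥ 1`, `a > 0`, `p′ = s` with
`|s_ν| ≤ π`, `s ≠ 0`; the class `k ∈ (ℤ/n)^d` is represented by `q_k = symmAlias n k s`
(`B5Hk163RateSum.isRep_symmAlias`), level-`N` classes are PAIRED with level-`RN` classes by
`ι = B5Hk163RateSum.iota` (`symmAlias (RN) (ι k) s = symmAlias N k s`), the remaining level-`RN` classes are
UNPAIRED («`m ≠ 0`», `‖q″‖ ≥ πN`, `B5Hk163RateSum.norm_ge_of_unpaired`); `C(d, β) = King1986.aliasConst d β`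
is the typed constant of (4.22), `γ₀ = T4GaugeActionRate.gam0 d`).
 §0 book-keeping: factorised double sums, a three-term splitting `Σ_kΣ_{k′}E ≤ K(ρ·ΣF·ΣG + Σ(εF)·ΣG +
    ΣF·Σ(ε′G))` of a rate whose per-entry coefficient is `ρ + ε_k + ε′_{k′}` (`sum_sum_rate_le`),
    `0 ≤ C(d, β)`, `rpow` identities.
 §1 the x-vector majorant `xMaj` and the aliased bracket majorant `bMajA` of `B5G183Rate` at an alias point
    `q = p′ + 2πj`, `j ≠ 0`, are bounded by `CXa·W(j)/‖q‖²` resp. `CBa·W(j)/‖q‖²` (`W` = King's weight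
    `aliasWeight`), i.e. by `aliasTerm (−1)`: NO spare power of momentum is spent, so the η-currency
    `|q|₁/N ≤ d‖q‖/N` costs exactly one power and lands in `aliasTerm 0` — both exponents `< 1`, (4.22)
    applies with `γ = 1`.  At the zone centre `xMaj(p′) = D(p′) = (π²/4)|p′|⁻²` is NOT uniform, but
    `Δ₀(p′)·D(p′) ≤ π²/4` (`Delta1r_mul_Dq_le`): the printed «additional factor Δ₀» pays for it.
 §2 per-class majorants `xM`, `bM` (centre form `|p′_μ|·MrS` at `k = 0`, aliased form otherwise) and rate
    coefficients `xe`, `be`; the per-class entry bounds and rates at every level `m ≥ N` (from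
    `B5G183Rate.norm_xP_le / xP_rate / norm_bR_le_alias / bR_rate_alias / norm_bR_zero_le' / bR_zero_rate`);
    the SINGLE alias sums with explicit constants: `Σ_{k≠0} xM ≤ SX`, `Σ_{k≠0} xe·xM ≤ SXe/N`,
    `Σ_k (Δ₀/γ₀)xM ≤ KX`, `Σ_k (Δ₀/γ₀)xe·xM ≤ KXe/N`, `Σ_k bM ≤ SB`, `Σ_k be·bM ≤ SBe/N`, and over the
    UNPAIRED level-`RN` classes `Σ xM ≤ SXu/N`, `Σ bM ≤ SBu/N` (one `‖q″‖⁻¹ ≤ (πN)⁻¹`).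
 §3 the X-BLOCK entries `xEnt(k,k′) = cX·xP(q_k)·conj xP(q_{k′})`, all `(k,k′) ≠ (0,0)`: uniform bounds
    `Σ_{k≠0}Σ_{k′}‖xEnt‖ ≤ SX·KX`, `Σ_{k′≠0}‖xEnt(0,k′)‖ ≤ (π²/4γ₀)·SX`; PAIRED η-rates
    `Σ_{k≠0}Σ_{k′}‖xEnt^{(N)}(k,k′) − xEnt^{(RN)}(ιk,ιk′)‖ ≤ CXr/N`, `Σ_{k′≠0}‖… (0,k′) …‖ ≤ CX0r/N`;
    UNPAIRED rows / columns at level `RN` `≤ SXu·KX/N`.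
 §4 the RANK-ONE entries `rEnt(k,k′) = cB·bR_μ(q_k)·conj bR_ν(q_{k′})`, ALL `(k,k′)`: `Σ_kΣ_{k′}‖rEnt‖ ≤
    ((4d+a)/a)·SB²`; PAIRED η-rate `≤ CRr/N`; UNPAIRED rows / columns `≤ ((4d+a)/a)·SBu·SB/N`.
 §5 the FREE DIAGONAL per mode (it is not summable in `l`): paired classes `|Δ^{(N)}(q_k)⁻¹ − Δ^{(RN)}(q_k)⁻¹|
    ≤ (π²/24)N⁻²` for every `k` (King (4.31), `B5G183Rate.inv_DeltaXir_sub_abs`), unpaired classes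
    `0 < Δ^{(RN)}(q″)⁻¹ ≤ (4N²)⁻¹`; and the assembled statements `finiteRank_l1_le` (uniform entrywise `ℓ¹`
    bound of x-block-minus-corner + rank-one block), `finiteRank_paired_rate` (`≤ (CX0r + CXr + CRr)/N`),
    `finiteRank_unpaired_le` (`O(1/N)`).  The (0,0) corner of the x-block together with the `l = 0` free
    mode is (1.87)'s `dZ`, rated `O(N⁻²)` in `B5G183Rate.dZ_rate'` (by name; not re-summed here).
 Every hypothesis of every theorem is `1 ≤ N`, `1 ≤ R`, `0 < a`, `|s_ν| ≤ π`, `s_{ν₀} ≠ 0`; there is NO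
 perturbative / background / (B), (B^μ) / `BetaPertH` conditional anywhere in this file (linear theory,
 `U = 1`), and the η-currency is `1/N` with no loss (`γ = 1`): the finite-rank majorants decay one power
 faster than (4.22) needs.

WHAT IS NOT CLAIMED (typed residuals, owners wanted — see the cell records): (i) an OPERATOR statement on
`L²(T_η)` or `ℓ²((ℤ/n)^d × d)`: the entrywise `ℓ¹` sums typed here dominate the Schur row/column sums of the
finite-rank part, but no operator norm, no `Fiber.G`-level inequality and no identification with `Δ_a⁻¹`
((1.73)–(1.82), b05's side) is typed in this file; (ii) the printed «differentiated two times at most» /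
«derivatives up to the second» (derivatives in `p′`): not typed; (iii) the FREE DIAGONAL as a kernel in
position space (lattice Green's function; only its per-mode rate is here) and any position-space decay;
(iv) the exponential decay of Prop. 1.2 ((1.110)–(1.111) p. 35, § F; Prop. 1.1 p. 33 is the `L²` bound
(1.89)–(1.90), NOT a decay statement), `U ≠ 1`, (1.99) and the later papers; (v) optimality of any
constant (`CXa`, `CBa`, `SX`, …, `CRr` are crude products of the sibling constants and `C(d, β)`).
-/

noncomputable section

namespace Literature.MathematicalPhysics.QuantumFieldTheory.Balaban1983to89.B5G183RateSum

open scoped BigOperators ComplexConjugate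
open Finset Complex
open Literature.MathematicalPhysics.QuantumFieldTheory.Balaban1983to89.B4Strip
open Literature.MathematicalPhysics.QuantumFieldTheory.Balaban1983to89.B5Prop11Leaves
open Literature.MathematicalPhysics.QuantumFieldTheory.Balaban1983to89.B5ActionRate166 (Cphi Cpsi)
open Literature.MathematicalPhysics.QuantumFieldTheory.Balaban1983to89.B5Hk163Rate
open Literature.MathematicalPhysics.QuantumFieldTheory.Balaban1983to89.B5Hk163RateSum
open Literature.MathematicalPhysics.QuantumFieldTheory.Balaban1983to89.B5G183Rate
open Literature.MathematicalPhysics.QuantumFieldTheory.King1986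

variable {d : ℕ}

/-! ## §0 Book-keeping: double sums of factorised majorants, the alias constant, `rpow` identities -/

/-- `Σ_k Σ_{k′} c·(f_k·g_{k′}) = c·(Σ f)(Σ g)`. [folklore] -/
theorem sum_sum_const_mul {ι₁ ι₂ : Type*} (A : Finset ι₁) (B : Finset ι₂) (c : ℝ) (f : ι₁ → ℝ) (g : ι₂ → ℝ) :
    ∑ k ∈ A, ∑ k' ∈ B, c * (f k * g k') = c * ((∑ k ∈ A, f k) * (∑ k' ∈ B, g k')) := by
  rw [Finset.sum_mul_sum, Finset.mul_sum]
  exact Finset.sum_congr rfl fun _ _ => by rw [Finset.mul_sum]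

/-- a double sum dominated termwise by a factorised majorant `c·F_k·G_{k′}` is `≤ c·(Σ F)(Σ G)`. [folklore] -/
theorem sum_sum_le_of_le_mul {ι₁ ι₂ : Type*} (A : Finset ι₁) (B : Finset ι₂) {E : ι₁ → ι₂ → ℝ}
    {F : ι₁ → ℝ} {G : ι₂ → ℝ} {c : ℝ} (h : ∀ k ∈ A, ∀ k' ∈ B, E k k' ≤ c * F k * G k') :
    ∑ k ∈ A, ∑ k' ∈ B, E k k' ≤ c * (∑ k ∈ A, F k) * (∑ k' ∈ B, G k') := by
  calc ∑ k ∈ A, ∑ k' ∈ B, E k k' ≤ ∑ k ∈ A, ∑ k' ∈ B, c * (F k * G k') :=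
        Finset.sum_le_sum fun k hk => Finset.sum_le_sum fun k' hk' => (h k hk k' hk').trans_eq (mul_assoc _ _ _)
    _ = c * (∑ k ∈ A, F k) * (∑ k' ∈ B, G k') := by rw [sum_sum_const_mul, mul_assoc]

/-- **the summed form of King's replacement scheme**: if every entry difference is dominated by
`(ρ + ε_k + ε′_{k′})·(K·F_k·G_{k′})` (coefficient rate + the two factor rates, times the product majorant),
the double sum is `≤ K·(ρ·ΣF·ΣG + Σ(εF)·ΣG + ΣF·Σ(ε′G))`. [cite: King1986, p.672 («we successively replace
each factor by the corresponding one … and bound the error»)] [folklore] -/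
theorem sum_sum_rate_le {ι₁ ι₂ : Type*} (A : Finset ι₁) (B : Finset ι₂) {E : ι₁ → ι₂ → ℝ}
    {F ε : ι₁ → ℝ} {G ε' : ι₂ → ℝ} {ρ K : ℝ}
    (h : ∀ k ∈ A, ∀ k' ∈ B, E k k' ≤ (ρ + ε k + ε' k') * (K * F k * G k')) :
    ∑ k ∈ A, ∑ k' ∈ B, E k k'
      ≤ K * (ρ * (∑ k ∈ A, F k) * (∑ k' ∈ B, G k') + (∑ k ∈ A, ε k * F k) * (∑ k' ∈ B, G k')
          + (∑ k ∈ A, F k) * (∑ k' ∈ B, ε' k' * G k')) := by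
  calc ∑ k ∈ A, ∑ k' ∈ B, E k k'
      ≤ ∑ k ∈ A, ∑ k' ∈ B, (ρ + ε k + ε' k') * (K * F k * G k') :=
        Finset.sum_le_sum fun k hk => Finset.sum_le_sum fun k' hk' => h k hk k' hk'
    _ = ∑ k ∈ A, ∑ k' ∈ B, (K * ρ * (F k * G k')
          + (K * ((ε k * F k) * G k') + K * (F k * (ε' k' * G k')))) :=
        Finset.sum_congr rfl fun _ _ => Finset.sum_congr rfl fun _ _ => by ring
    _ = K * ρ * ((∑ k ∈ A, F k) * (∑ k' ∈ B, G k'))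
          + (K * ((∑ k ∈ A, ε k * F k) * (∑ k' ∈ B, G k'))
            + K * ((∑ k ∈ A, F k) * (∑ k' ∈ B, ε' k' * G k'))) := by
        simp only [Finset.sum_add_distrib]
        rw [sum_sum_const_mul, sum_sum_const_mul, sum_sum_const_mul]
    _ = _ := by ring

/-- King's alias constant is nonnegative (the empty sub-sum of (4.22)). [folklore] -/
theorem aliasConst_nonneg (hd : 0 < d) {β : ℝ} (hβ : β < 1) : 0 ≤ aliasConst d β := by
  have h := King1986.alias_sum_le_of_subset hd hβ (p := fun _ : Fin d => (0 : ℝ))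
    (fun _ => by rw [abs_zero]; exact Real.pi_pos.le) (Λ := ∅) (by simp)
  simpa using h

/-- `w/x² = x^{(−1)−1}·w` (the `β = −1` alias term). [folklore] -/
theorem div_sq_eq_rpow {x : ℝ} (hx : 0 < x) (w : ℝ) : w / x ^ 2 = x ^ ((-1 : ℝ) - 1) * w := by
  rw [show ((-1 : ℝ) - 1) = -(2 : ℝ) by norm_num, Real.rpow_neg hx.le, Real.rpow_two, inv_mul_eq_div]

/-- `x·(w/x²) = x^{0−1}·w` (the `β = 0` alias term). [folklore] -/
theorem mul_div_sq_eq_rpow {x : ℝ} (hx : 0 < x) (w : ℝ) : x * (w / x ^ 2) = x ^ ((0 : ℝ) - 1) * w := by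
  rw [zero_sub, Real.rpow_neg_one, show w / x ^ 2 = x⁻¹ * (x⁻¹ * w) by field_simp, ← mul_assoc,
    mul_inv_cancel₀ hx.ne', one_mul]

/-- far-out classes: for `x ≥ M > 0`, `w ≥ 0`: `w/x² ≤ (x^{0−1}·w)·M⁻¹`. [folklore] -/
theorem div_sq_le_rpow_mul_inv {x M w : ℝ} (hM : 0 < M) (hxM : M ≤ x) (hw : 0 ≤ w) :
    w / x ^ 2 ≤ x ^ ((0 : ℝ) - 1) * w * M⁻¹ := by
  have hx : 0 < x := lt_of_lt_of_le hM hxM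
  rw [zero_sub, Real.rpow_neg_one, show w / x ^ 2 = x⁻¹ * w * x⁻¹ by field_simp]
  exact mul_le_mul_of_nonneg_left (inv_anti₀ hM hxM) (by positivity)

/-- `jOf n k p′ = 0 ↔ k = 0` (zone `|p′_ν| ≤ π`, `n ≥ 1`). [folklore] -/
theorem jOf_eq_zero_iff {n : ℕ} [NeZero n] (hn : 1 ≤ n) {s : Fin d → ℝ} (hs : ∀ ν, |s ν| ≤ Real.pi)
    (k : Fin d → Fin n) : jOf n k s = 0 ↔ k = 0 :=
  ⟨eq_zero_of_jOf_eq_zero, fun h => h ▸ jOf_zero hn hs⟩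

/-- the zero class is represented by `p′` itself. [folklore] -/
theorem symmAlias_zero {n : ℕ} [NeZero n] (hn : 1 ≤ n) {s : Fin d → ℝ} (hs : ∀ ν, |s ν| ≤ Real.pi) :
    symmAlias n (0 : Fin d → Fin n) s = s := by
  rw [symmAlias_eq_aliasPt, jOf_zero hn hs, aliasPt_zero]

/-- `p′ ≠ 0` from a nonzero coordinate. [folklore] -/
theorem ne_zero_of_apply {s : Fin d → ℝ} {ν₀ : Fin d} (hν₀ : s ν₀ ≠ 0) : s ≠ 0 :=
  fun h => hν₀ (by simp [h])

/-- the alias weight is nonnegative. [folklore] -/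
theorem aliasWeight_nonneg (p : Fin d → ℝ) (j : Fin d → ℤ) : 0 ≤ aliasWeight p j := by
  unfold King1986.aliasWeight
  exact Finset.prod_nonneg fun ν _ => by split_ifs <;> positivity

/-! ## §1 The x-block and bracket majorants at alias points, against King's alias weight -/

/-- the constant of the x-vector majorant at `l ≠ 0`: `(π/2)^{d+1}·π²/4`. [folklore] -/
def CXa (d : ℕ) : ℝ := (Real.pi / 2) ^ (d + 1) * (Real.pi ^ 2 / 4)

/-- `CXa ≥ 0`. [folklore] -/
theorem CXa_nonneg (d : ℕ) : 0 ≤ CXa d := by unfold CXa; positivity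

/-- `D(q) ≤ (π²/4)/‖q‖²` (sup norm). [folklore] -/
theorem Dq_le_norm {q : Fin d → ℝ} (hq : 0 < ‖q‖) : Dq q ≤ Real.pi ^ 2 / 4 / ‖q‖ ^ 2 := by
  unfold Dq
  exact div_le_div_of_nonneg_left (by positivity) (pow_pos hq 2) (norm_sq_le_momSq q)

/-- `U(q) ≤ (π/2)^d·aliasWeight` at an alias point. [cite: King1986, (4.20) p.672] [folklore] -/
theorem Uq_aliasPt_le (s : Fin d → ℝ) (j : Fin d → ℤ) :
    Uq s (aliasPt s j) ≤ (Real.pi / 2) ^ d * aliasWeight s j :=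
  prod_vMaj_aliasPt_le s j

/-- **x-vector majorant at `l ≠ 0`**: `xMaj(p′, p′+2πj, μ) ≤ CXa·aliasWeight(j)/‖p′+2πj‖²`, `j ≠ 0`.
[cite: King1986, (4.20)–(4.21) p.672] [folklore] -/
theorem xMaj_alias_le {s : Fin d → ℝ} (hs : ∀ ν, |s ν| ≤ Real.pi) {j : Fin d → ℤ} (hj : j ≠ 0) (μ : Fin d) :
    xMaj s (aliasPt s j) μ ≤ CXa d * aliasWeight s j / ‖aliasPt s j‖ ^ 2 := by
  have hπ := Real.pi_pos
  have hx : 0 < ‖aliasPt s j‖ := lt_of_lt_of_le hπ (pi_le_norm_aliasPt hs hj)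
  have hw := aliasWeight_nonneg s j
  have h1 := Uq_aliasPt_le s j
  have h2 := vMaj_aliasPt_le hs j μ
  have h3 := Dq_le_norm (q := aliasPt s j) hx
  unfold xMaj
  calc Uq s (aliasPt s j) * vMaj s (aliasPt s j) μ * Dq (aliasPt s j)
      ≤ ((Real.pi / 2) ^ d * aliasWeight s j) * (Real.pi / 2) * (Real.pi ^ 2 / 4 / ‖aliasPt s j‖ ^ 2) :=
        mul_le_mul (mul_le_mul h1 h2 (vMaj_nonneg _ _ _) (by positivity)) h3 (Dq_nonneg _) (by positivity)
    _ = CXa d * aliasWeight s j / ‖aliasPt s j‖ ^ 2 := by unfold CXa; ring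

/-- at the zone centre the x-vector majorant is King's `D(p′)` (`U(p′) = vMaj_μ(p′) = 1`). [folklore] -/
theorem xMaj_self (s : Fin d → ℝ) (μ : Fin d) : xMaj s s μ = Dq s := by
  simp [xMaj, Uq, vMaj]

/-- `Δ₀(p′)·D(p′) ≤ π²/4` (`Δ₀ ≤ |p′|²`): the «additional factor Δ₀» makes the centre term bounded. [folklore] -/
theorem Delta1r_mul_Dq_le {s : Fin d → ℝ} (hs : ∀ ν, |s ν| ≤ Real.pi) (ν₀ : Fin d) (hν₀ : s ν₀ ≠ 0) :
    Delta1r 0 s * Dq s ≤ Real.pi ^ 2 / 4 := by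
  have hm : 0 < momSq s := momSq_pos_of_rep hs ν₀ hν₀ fun ν => ⟨0, by simp⟩
  have hle : Delta1r 0 s ≤ momSq s := by
    have h := Delta1r_le_momSq_aliasPt hs 0
    rwa [aliasPt_zero] at h
  have h1 : Delta1r 0 s / momSq s ≤ 1 := (div_le_one hm).mpr hle
  have hπ : 0 < Real.pi ^ 2 / 4 := by positivity
  unfold Dq
  calc Delta1r 0 s * (Real.pi ^ 2 / 4 / momSq s) = Delta1r 0 s / momSq s * (Real.pi ^ 2 / 4) := by ring
    _ ≤ 1 * (Real.pi ^ 2 / 4) := mul_le_mul_of_nonneg_right h1 hπ.le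
    _ = Real.pi ^ 2 / 4 := one_mul _

/-- the constant of the bracket majorant at `l ≠ 0`: `(π/2)^d·(π²/4)·(πd + π²/2)/γ₀`. [folklore] -/
def CBa (d : ℕ) : ℝ :=
  (Real.pi / 2) ^ d * (Real.pi ^ 2 / 4) * (Real.pi * d + Real.pi ^ 2 / 2) / T4GaugeActionRate.gam0 d

/-- `CBa ≥ 0`. [folklore] -/
theorem CBa_nonneg (d : ℕ) : 0 ≤ CBa d := by
  have := T4GaugeActionRate.gam0_pos d
  unfold CBa; positivity

/-- **bracket majorant at `l ≠ 0`**: `bMajA(p′, p′+2πj, μ) ≤ CBa·aliasWeight(j)/‖p′+2πj‖²`, `j ≠ 0`.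
[cite: King1986, (4.20)–(4.21) p.672] [folklore] -/
theorem bMajA_alias_le {s : Fin d → ℝ} (hs : ∀ ν, |s ν| ≤ Real.pi) {j : Fin d → ℤ} (hj : j ≠ 0) (μ : Fin d) :
    bMajA d s (aliasPt s j) μ ≤ CBa d * aliasWeight s j / ‖aliasPt s j‖ ^ 2 := by
  set q := aliasPt s j with hq_def
  have hπ := Real.pi_pos
  have hπ3 := Real.pi_gt_three
  have hg := T4GaugeActionRate.gam0_pos d
  have hxπ : Real.pi ≤ ‖q‖ := pi_le_norm_aliasPt hs hj
  have hx : 0 < ‖q‖ := lt_of_lt_of_le hπ hxπ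
  have hw := aliasWeight_nonneg s j
  have hU := Uq_aliasPt_le s j
  have hD := Dq_le_norm (q := q) hx
  have hD4 : Delta1r 0 s ≤ 4 * d := Delta1r_le s
  have hD0 : 0 ≤ Delta1r 0 s := by
    unfold Delta1r; rw [add_zero]; exact Finset.sum_nonneg fun ν _ => S1r_nonneg (s ν)
  -- the two bracket terms
  have t1 : |q μ| * Dq q * Delta1r 0 s ≤ Real.pi * d := by
    have hqμ : |q μ| ≤ ‖q‖ := abs_apply_le_norm q μ
    calc |q μ| * Dq q * Delta1r 0 s ≤ ‖q‖ * (Real.pi ^ 2 / 4 / ‖q‖ ^ 2) * (4 * d) :=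
          mul_le_mul (mul_le_mul hqμ hD (Dq_nonneg _) (norm_nonneg _)) hD4 hD0 (by positivity)
      _ = Real.pi ^ 2 * d / ‖q‖ := by field_simp
      _ ≤ Real.pi ^ 2 * d / Real.pi := div_le_div_of_nonneg_left (by positivity) hπ hxπ
      _ = Real.pi * d := by field_simp
  have t2 : vMaj s q μ * |s μ| ≤ Real.pi / 2 * Real.pi :=
    mul_le_mul (vMaj_aliasPt_le hs j μ) (hs μ) (abs_nonneg _) (by positivity)
  have hbr : |q μ| * Dq q * Delta1r 0 s + vMaj s q μ * |s μ| ≤ Real.pi * d + Real.pi ^ 2 / 2 := by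
    nlinarith
  have hbr0 : 0 ≤ |q μ| * Dq q * Delta1r 0 s + vMaj s q μ * |s μ| := by
    have := Dq_nonneg q; have := vMaj_nonneg s q μ; positivity
  unfold bMajA
  calc Uq s q * Dq q / T4GaugeActionRate.gam0 d * (|q μ| * Dq q * Delta1r 0 s + vMaj s q μ * |s μ|)
      ≤ ((Real.pi / 2) ^ d * aliasWeight s j) * (Real.pi ^ 2 / 4 / ‖q‖ ^ 2) / T4GaugeActionRate.gam0 d
          * (Real.pi * d + Real.pi ^ 2 / 2) := by
        refine mul_le_mul ?_ hbr hbr0 (by positivity)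
        exact div_le_div_of_nonneg_right (mul_le_mul hU hD (Dq_nonneg _) (by positivity)) hg.le
    _ = CBa d * aliasWeight s j / ‖q‖ ^ 2 := by unfold CBa; field_simp


/-! ## §2 The per-class majorants on the torus and their single alias sums -/

section Single

variable {N R : ℕ} [NeZero N] [NeZero R]

/-- the x-vector majorant of the class `k ∈ (ℤ/n)^d` (at its symmetric representative `q_k`). [folklore] -/
def xM (n : ℕ) (s : Fin d → ℝ) (μ : Fin d) (k : Fin d → Fin n) : ℝ := xMaj s (symmAlias n k s) μ

/-- the relative η-rate coefficient of the x-vector of the class `k ∈ (ℤ/N)^d`: `Ax·|q_k|₁/N`. [folklore] -/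
def xe (N : ℕ) (s : Fin d → ℝ) (k : Fin d → Fin N) : ℝ := Ax d * ((∑ ν, |symmAlias N k s ν|) / N)

omit [NeZero N] in
/-- `xM ≥ 0`. [folklore] -/
theorem xM_nonneg (s : Fin d → ℝ) (μ : Fin d) (k : Fin d → Fin N) : 0 ≤ xM N s μ k := xMaj_nonneg _ _ _

omit [NeZero N] in
/-- `xe ≥ 0`. [folklore] -/
theorem xe_nonneg (s : Fin d → ℝ) (k : Fin d → Fin N) : 0 ≤ xe N s k := by
  unfold xe Ax; positivity

omit [NeZero N] in
/-- `‖xP^{(m)}_μ(q_k)‖ ≤ xM_k` at every level `m ≥ N` (the representative `q_k` of the level-`N` class lies in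
every coarser-or-equal zone). [cite: King1986, (4.20)–(4.21) p.672] [folklore] -/
theorem norm_xP_le_xM {m : ℕ} [NeZero m] (hm : 1 ≤ m) (hNm : N ≤ m) (hN : 1 ≤ N) {s : Fin d → ℝ}
    (hs : ∀ ν, |s ν| ≤ Real.pi) (ν₀ : Fin d) (hν₀ : s ν₀ ≠ 0) (μ : Fin d) (k : Fin d → Fin N) :
    ‖xP m μ (symmAlias N k s)‖ ≤ xM N s μ k := by
  have hr := isRep_symmAlias hN k hs
  have hq : ∀ ν, |symmAlias N k s ν| ≤ Real.pi * m := fun ν =>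
    (hr.zone ν).trans (mul_le_mul_of_nonneg_left (by exact_mod_cast hNm) Real.pi_pos.le)
  exact norm_xP_le hm hs hq (momSq_pos_of_rep hs ν₀ hν₀ hr.exists_int) hr.exists_int μ

omit [NeZero N] [NeZero R] in
/-- the per-class x-vector η-rate: `‖xP^{(N)}(q_k) − xP^{(RN)}(q_k)‖ ≤ xe_k·xM_k`. [cite: King1986, (4.29)/(4.31)
p.673] [folklore] -/
theorem xP_rate_le (hN : 1 ≤ N) (hR : 1 ≤ R) {s : Fin d → ℝ} (hs : ∀ ν, |s ν| ≤ Real.pi) (ν₀ : Fin d)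
    (hν₀ : s ν₀ ≠ 0) (μ : Fin d) (k : Fin d → Fin N) :
    ‖xP N μ (symmAlias N k s) - xP (R * N) μ (symmAlias N k s)‖ ≤ xe N s k * xM N s μ k := by
  have hr := isRep_symmAlias hN k hs
  exact xP_rate hN hR hs hr.zone (momSq_pos_of_rep hs ν₀ hν₀ hr.exists_int) hr.exists_int μ

/-- the constant of `Σ_{l ≠ 0} xMaj`: `CXa·C(d, −1)`. [folklore] -/
def SX (d : ℕ) : ℝ := CXa d * aliasConst d (-1)

/-- the constant of `Σ_{l ≠ 0} (|q|₁/N)·xMaj` (times `N`): `Ax·d·CXa·C(d, 0)`. [folklore] -/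
def SXe (d : ℕ) : ℝ := Ax d * d * CXa d * aliasConst d 0

/-- the constant of `Σ_l (Δ₀/γ₀)·xMaj` (zone centre included): `π²/(4γ₀) + (4d/γ₀)·SX`. [folklore] -/
def KX (d : ℕ) : ℝ := Real.pi ^ 2 / 4 / T4GaugeActionRate.gam0 d + 4 * d / T4GaugeActionRate.gam0 d * SX d

/-- the constant of `Σ_l (Δ₀/γ₀)·(|q|₁/N)·xMaj` (times `N`): `(π²/(4γ₀))·Ax·dπ + (4d/γ₀)·SXe`. [folklore] -/
def KXe (d : ℕ) : ℝ :=
  Real.pi ^ 2 / 4 / T4GaugeActionRate.gam0 d * (Ax d * (d * Real.pi)) + 4 * d / T4GaugeActionRate.gam0 d * SXe d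

/-- the constant of the unpaired x-sum (times `N`): `CXa·C(d, 0)/π`. [folklore] -/
def SXu (d : ℕ) : ℝ := CXa d * aliasConst d 0 / Real.pi

omit [NeZero N] [NeZero R] in
/-- nonnegativity of the x-constants. [folklore] -/
theorem x_consts_nonneg (hd : 0 < d) : 0 ≤ SX d ∧ 0 ≤ SXe d ∧ 0 ≤ KX d ∧ 0 ≤ KXe d ∧ 0 ≤ SXu d := by
  have hg := T4GaugeActionRate.gam0_pos d
  have h1 := aliasConst_nonneg hd (β := -1) (by norm_num)
  have h0 := aliasConst_nonneg hd (β := 0) (by norm_num)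
  have hC := CXa_nonneg d
  have hA : 0 ≤ Ax d := by unfold Ax; positivity
  have hSX : 0 ≤ SX d := by unfold SX; positivity
  have hSXe : 0 ≤ SXe d := by unfold SXe; positivity
  refine ⟨hSX, hSXe, ?_, ?_, ?_⟩
  · unfold KX; positivity
  · unfold KXe; positivity
  · unfold SXu; positivity

omit [NeZero N] in
/-- `xM_k ≤ CXa·aliasTerm(−1)(jOf k)` for `k ≠ 0`. [folklore] -/
theorem xM_le_aliasTerm {s : Fin d → ℝ} (hs : ∀ ν, |s ν| ≤ Real.pi) (μ : Fin d)
    {k : Fin d → Fin N} (hk : jOf N k s ≠ 0) : xM N s μ k ≤ CXa d * aliasTerm (-1) s (jOf N k s) := by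
  have hx : 0 < ‖aliasPt s (jOf N k s)‖ := lt_of_lt_of_le Real.pi_pos (pi_le_norm_aliasPt hs hk)
  unfold xM
  rw [symmAlias_eq_aliasPt]
  refine (xMaj_alias_le hs hk μ).trans_eq ?_
  unfold King1986.aliasTerm
  rw [mul_div_assoc, div_sq_eq_rpow hx]

omit [NeZero N] in
/-- `xe_k·xM_k ≤ (Ax·d·CXa/N)·aliasTerm(0)(jOf k)` for `k ≠ 0` (`|q|₁ ≤ d‖q‖` trades one power). [folklore] -/
theorem xe_xM_le_aliasTerm (hN : 1 ≤ N) {s : Fin d → ℝ} (hs : ∀ ν, |s ν| ≤ Real.pi) (μ : Fin d)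
    {k : Fin d → Fin N} (hk : jOf N k s ≠ 0) :
    xe N s k * xM N s μ k ≤ Ax d * d * CXa d / N * aliasTerm 0 s (jOf N k s) := by
  have hN0 : (0 : ℝ) < N := by exact_mod_cast hN
  set j := jOf N k s with hj
  have hq : symmAlias N k s = aliasPt s j := by rw [symmAlias_eq_aliasPt]
  have hx : 0 < ‖aliasPt s j‖ := lt_of_lt_of_le Real.pi_pos (pi_le_norm_aliasPt hs hk)
  have hw := aliasWeight_nonneg s j
  have hA : 0 ≤ Ax d := by unfold Ax; positivity
  have h1 : (∑ ν, |aliasPt s j ν|) / N ≤ d * ‖aliasPt s j‖ / N :=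
    div_le_div_of_nonneg_right (sum_abs_le_norm _) hN0.le
  have h2 := xMaj_alias_le hs hk μ
  unfold xe xM
  rw [hq]
  calc Ax d * ((∑ ν, |aliasPt s j ν|) / N) * xMaj s (aliasPt s j) μ
      ≤ Ax d * (d * ‖aliasPt s j‖ / N) * (CXa d * aliasWeight s j / ‖aliasPt s j‖ ^ 2) :=
        mul_le_mul (mul_le_mul_of_nonneg_left h1 hA) h2 (xMaj_nonneg _ _ _) (by positivity)
    _ = Ax d * d * CXa d / N * (‖aliasPt s j‖ * (aliasWeight s j / ‖aliasPt s j‖ ^ 2)) := by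
        field_simp
    _ = Ax d * d * CXa d / N * aliasTerm 0 s j := by
        rw [mul_div_sq_eq_rpow hx]; rfl

/-- **`Σ_{l ≠ 0} xMaj ≤ SX`** (King (4.22) with `β = −1`). [cite: King1986, (4.22) p.672] [folklore] -/
theorem sum_xM_ne_le (hN : 1 ≤ N) {s : Fin d → ℝ} (hs : ∀ ν, |s ν| ≤ Real.pi) (ν₀ : Fin d) (μ : Fin d) :
    ∑ k ∈ Finset.univ.erase (0 : Fin d → Fin N), xM N s μ k ≤ SX d := by
  have hd : 0 < d := Fin.pos ν₀
  unfold SX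
  refine sum_le_of_alias_bound' hd (β := -1) (by norm_num) hs _ _ (CXa_nonneg d) (fun k hk => ?_)
    (fun k hk => xM_le_aliasTerm hs μ ?_)
  all_goals exact fun h0 => (Finset.ne_of_mem_erase hk) ((jOf_eq_zero_iff hN hs k).mp h0)

/-- **`Σ_{l ≠ 0} (Ax|q_l|₁/N)·xMaj ≤ SXe/N`** (King (4.22) with `β = 0`). [cite: King1986, (4.22)–(4.24) p.672]
[folklore] -/
theorem sum_xe_xM_ne_le (hN : 1 ≤ N) {s : Fin d → ℝ} (hs : ∀ ν, |s ν| ≤ Real.pi) (ν₀ : Fin d) (μ : Fin d) :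
    ∑ k ∈ Finset.univ.erase (0 : Fin d → Fin N), xe N s k * xM N s μ k ≤ SXe d / N := by
  have hd : 0 < d := Fin.pos ν₀
  have hN0 : (0 : ℝ) < N := by exact_mod_cast hN
  have hA : 0 ≤ Ax d := by unfold Ax; positivity
  have hC := CXa_nonneg d
  have e : SXe d / N = Ax d * d * CXa d / N * aliasConst d 0 := by unfold SXe; ring
  rw [e]
  refine sum_le_of_alias_bound' hd (β := 0) (by norm_num) hs _ _ (by positivity) (fun k hk => ?_)
    (fun k hk => xe_xM_le_aliasTerm hN hs μ ?_)
  all_goals exact fun h0 => (Finset.ne_of_mem_erase hk) ((jOf_eq_zero_iff hN hs k).mp h0)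

/-- **`Σ_l (Δ₀/γ₀)·xMaj ≤ KX`**, zone centre INCLUDED: the «additional factor Δ₀» `cX ≤ Δ₀/γ₀` pays for the
centre term `D(p′) = (π²/4)|p′|⁻²`. [cite: Balaban1984PropagatorsI, p.32 («we even get an additional factor
Δ₀(p′)»)] [folklore] -/
theorem sum_D0_xM_le (hN : 1 ≤ N) {s : Fin d → ℝ} (hs : ∀ ν, |s ν| ≤ Real.pi) (ν₀ : Fin d) (hν₀ : s ν₀ ≠ 0)
    (μ : Fin d) :
    ∑ k : Fin d → Fin N, Delta1r 0 s / T4GaugeActionRate.gam0 d * xM N s μ k ≤ KX d := by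
  have hd : 0 < d := Fin.pos ν₀
  have hg := T4GaugeActionRate.gam0_pos d
  have hD4 : Delta1r 0 s ≤ 4 * d := Delta1r_le s
  have hD0 : 0 < Delta1r 0 s := Delta1r_pos s hs ν₀ hν₀
  have hSX := (x_consts_nonneg (d := d) hd).1
  have e : KX d = Real.pi ^ 2 / 4 / T4GaugeActionRate.gam0 d
      + 4 * d / T4GaugeActionRate.gam0 d * CXa d * aliasConst d (-1) := by unfold KX SX; ring
  rw [e]
  refine sum_le_of_alias_bound hd (β := -1) (by norm_num) hs _ (by positivity)
    (by have := CXa_nonneg d; positivity) (fun k hk => ?_) (fun k hk => ?_)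
  · rw [(jOf_eq_zero_iff hN hs k).mp hk]
    unfold xM
    rw [symmAlias_zero hN hs, xMaj_self, div_mul_eq_mul_div, div_le_div_iff_of_pos_right hg]
    exact Delta1r_mul_Dq_le hs ν₀ hν₀
  · calc Delta1r 0 s / T4GaugeActionRate.gam0 d * xM N s μ k
        ≤ 4 * d / T4GaugeActionRate.gam0 d * (CXa d * aliasTerm (-1) s (jOf N k s)) :=
          mul_le_mul (div_le_div_of_nonneg_right hD4 hg.le) (xM_le_aliasTerm hs μ hk) (xM_nonneg _ _ _)
            (by positivity)
      _ = 4 * d / T4GaugeActionRate.gam0 d * CXa d * aliasTerm (-1) s (jOf N k s) := by ring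

/-- **`Σ_l (Δ₀/γ₀)·(Ax|q_l|₁/N)·xMaj ≤ KXe/N`**, zone centre included. [folklore] -/
theorem sum_D0_xe_xM_le (hN : 1 ≤ N) {s : Fin d → ℝ} (hs : ∀ ν, |s ν| ≤ Real.pi) (ν₀ : Fin d) (hν₀ : s ν₀ ≠ 0)
    (μ : Fin d) :
    ∑ k : Fin d → Fin N, Delta1r 0 s / T4GaugeActionRate.gam0 d * (xe N s k * xM N s μ k) ≤ KXe d / N := by
  have hd : 0 < d := Fin.pos ν₀
  have hπ := Real.pi_pos
  have hN0 : (0 : ℝ) < N := by exact_mod_cast hN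
  have hg := T4GaugeActionRate.gam0_pos d
  have hD4 : Delta1r 0 s ≤ 4 * d := Delta1r_le s
  have hD0 : 0 < Delta1r 0 s := Delta1r_pos s hs ν₀ hν₀
  have hA : 0 ≤ Ax d := by unfold Ax; positivity
  have hC := CXa_nonneg d
  have e : KXe d / N = Real.pi ^ 2 / 4 / T4GaugeActionRate.gam0 d * (Ax d * (d * Real.pi)) / N
      + 4 * d / T4GaugeActionRate.gam0 d * (Ax d * d * CXa d / N) * aliasConst d 0 := by
    unfold KXe SXe; field_simp
  rw [e]
  refine sum_le_of_alias_bound hd (β := 0) (by norm_num) hs _ (by positivity) (by positivity)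
    (fun k hk => ?_) (fun k hk => ?_)
  · rw [(jOf_eq_zero_iff hN hs k).mp hk]
    unfold xM xe
    rw [symmAlias_zero hN hs, xMaj_self]
    have h1 : (∑ ν, |s ν|) ≤ d * Real.pi := (sum_abs_le_norm s).trans (by gcongr; exact norm_le_pi hs)
    have h2 := Delta1r_mul_Dq_le hs ν₀ hν₀
    have hDq := Dq_nonneg s
    calc Delta1r 0 s / T4GaugeActionRate.gam0 d * (Ax d * ((∑ ν, |s ν|) / N) * Dq s)
        = (Delta1r 0 s * Dq s) / T4GaugeActionRate.gam0 d * (Ax d * (∑ ν, |s ν|)) / N := by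
          field_simp
      _ ≤ (Real.pi ^ 2 / 4) / T4GaugeActionRate.gam0 d * (Ax d * (d * Real.pi)) / N := by
          gcongr
  · calc Delta1r 0 s / T4GaugeActionRate.gam0 d * (xe N s k * xM N s μ k)
        ≤ 4 * d / T4GaugeActionRate.gam0 d * (Ax d * d * CXa d / N * aliasTerm 0 s (jOf N k s)) :=
          mul_le_mul (div_le_div_of_nonneg_right hD4 hg.le) (xe_xM_le_aliasTerm hN hs μ hk)
            (mul_nonneg (xe_nonneg _ _) (xM_nonneg _ _ _)) (by positivity)
      _ = 4 * d / T4GaugeActionRate.gam0 d * (Ax d * d * CXa d / N) * aliasTerm 0 s (jOf N k s) := by ring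

/-- **the UNPAIRED level-`RN` classes** («|m| ≥ 1»): `Σ_{k″ unpaired} xMaj(q_{k″}) ≤ SXu/N` — each has
`‖q″‖ ≥ πN`, which converts one `‖q″‖⁻¹` into `N⁻¹`. [cite: King1986, (4.23) p.672] [folklore] -/
theorem sum_xM_unpaired_le (hN : 1 ≤ N) {s : Fin d → ℝ} (hs : ∀ ν, |s ν| ≤ Real.pi)
    (ν₀ : Fin d) (μ : Fin d) :
    ∑ k'' ∈ Finset.univ.filter (fun k'' => ∀ k : Fin d → Fin N, iota R k s ≠ k''), xM (R * N) s μ k''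
      ≤ SXu d / N := by
  classical
  have hd : 0 < d := Fin.pos ν₀
  have hπ := Real.pi_pos
  have hN0 : (0 : ℝ) < N := by exact_mod_cast hN
  have hC := CXa_nonneg d
  have e : SXu d / N = CXa d * (Real.pi * N)⁻¹ * aliasConst d 0 := by unfold SXu; field_simp
  rw [e]
  refine sum_le_of_alias_bound' hd (β := 0) (by norm_num) hs _ _ (by positivity) (fun k'' hk'' => ?_)
    (fun k'' hk'' => ?_)
  · simp only [Finset.mem_filter, Finset.mem_univ, true_and] at hk''
    exact jOf_ne_zero_of_unpaired hN hs hk''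
  · simp only [Finset.mem_filter, Finset.mem_univ, true_and] at hk''
    have hj0 := jOf_ne_zero_of_unpaired hN hs hk''
    set j := jOf (R * N) k'' s with hj
    have hq : symmAlias (R * N) k'' s = aliasPt s j := by rw [symmAlias_eq_aliasPt]
    have hfar : Real.pi * N ≤ ‖aliasPt s j‖ := by rw [← hq]; exact norm_ge_of_unpaired hN hs hk''
    have hw := aliasWeight_nonneg s j
    unfold xM
    rw [hq]
    calc xMaj s (aliasPt s j) μ ≤ CXa d * aliasWeight s j / ‖aliasPt s j‖ ^ 2 := xMaj_alias_le hs hj0 μ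
      _ = CXa d * (aliasWeight s j / ‖aliasPt s j‖ ^ 2) := mul_div_assoc _ _ _
      _ ≤ CXa d * (‖aliasPt s j‖ ^ ((0 : ℝ) - 1) * aliasWeight s j * (Real.pi * N)⁻¹) :=
          mul_le_mul_of_nonneg_left (div_sq_le_rpow_mul_inv (by positivity) hfar hw) hC
      _ = CXa d * (Real.pi * N)⁻¹ * aliasTerm 0 s j := by unfold King1986.aliasTerm; ring

/-! ### the bracket side: one majorant for all classes (centre form at `l = 0`, aliased form at `l ≠ 0`) -/

/-- the bracket majorant of the class `k`: `|p′_μ|·MrS` at `k = 0` ((1.88) form), `bMajA(q_k)` otherwise.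
[folklore] -/
def bM (n : ℕ) [NeZero n] (a : ℝ) (s : Fin d → ℝ) (μ : Fin d) (k : Fin d → Fin n) : ℝ :=
  if k = 0 then |s μ| * MrS d a else bMajA d s (symmAlias n k s) μ

/-- the relative η-rate coefficient of the bracket of the class `k ∈ (ℤ/N)^d`: the centre coefficient of
`bR_zero_rate` at `k = 0`, `Ab|q_k|₁/N + Bb/N²` otherwise. [folklore] -/
def be (N : ℕ) [NeZero N] (a : ℝ) (s : Fin d → ℝ) (k : Fin d → Fin N) : ℝ :=
  if k = 0 then
    (1 + (Real.pi / 2) ^ (d + 1)) * ((∑ ν, |s ν|) / N) + CrS d a (Delta1r 0 s) / MrS d a * ((N : ℝ) ^ 2)⁻¹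
  else B5G183Rate.Ab d * ((∑ ν, |symmAlias N k s ν|) / N) + Bb d * ((N : ℝ) ^ 2)⁻¹

/-- `bM ≥ 0`. [folklore] -/
theorem bM_nonneg {a : ℝ} (ha : 0 < a) (s : Fin d → ℝ) (μ : Fin d) (k : Fin d → Fin N) : 0 ≤ bM N a s μ k := by
  unfold bM
  split_ifs
  · have := MrS_pos d ha; positivity
  · exact bMajA_nonneg _ _ _

/-- `be ≥ 0` (zone `p′ ≠ 0`). [folklore] -/
theorem be_nonneg {a : ℝ} (ha : 0 < a) {s : Fin d → ℝ} (hs : ∀ ν, |s ν| ≤ Real.pi) (ν₀ : Fin d)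
    (hν₀ : s ν₀ ≠ 0) (k : Fin d → Fin N) : 0 ≤ be N a s k := by
  unfold be
  split_ifs
  · have := MrS_pos d ha
    have := (CrS_nonneg_mono d ha (Delta1r_pos s hs ν₀ hν₀).le le_rfl).1
    positivity
  · have : 0 ≤ B5G183Rate.Ab d := by unfold B5G183Rate.Ab; positivity
    have : 0 ≤ Bb d := by
      unfold Bb; have := B5ActionRate166.Cphi_pos; have := B5ActionRate166.Cpsi_pos
      have := T4GaugeActionRate.gam0_pos d; positivity
    positivity

/-- `‖bR^{(m)}_μ(q_k)‖ ≤ bM_k` at every level `m ≥ N`. [folklore] -/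
theorem norm_bR_le_bM {m : ℕ} [NeZero m] (hm : 1 ≤ m) (hNm : N ≤ m) (hN : 1 ≤ N) (a : ℝ) (ha : 0 < a)
    {s : Fin d → ℝ} (hs : ∀ ν, |s ν| ≤ Real.pi) (ν₀ : Fin d) (hν₀ : s ν₀ ≠ 0) (μ : Fin d)
    (k : Fin d → Fin N) : ‖bR m a μ (symmAlias N k s) s‖ ≤ bM N a s μ k := by
  unfold bM
  split_ifs with hk
  · rw [hk, symmAlias_zero hN hs]
    exact norm_bR_zero_le' hm a ha μ hs (ne_zero_of_apply hν₀)
  · have hr := isRep_symmAlias hN k hs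
    have hq : ∀ ν, |symmAlias N k s ν| ≤ Real.pi * m := fun ν =>
      (hr.zone ν).trans (mul_le_mul_of_nonneg_left (by exact_mod_cast hNm) Real.pi_pos.le)
    exact norm_bR_le_alias hm a ha hs ν₀ hν₀ hq hr.exists_int μ

/-- the per-class bracket η-rate: `‖bR^{(N)}(q_k) − bR^{(RN)}(q_k)‖ ≤ be_k·bM_k` (centre: `bR_zero_rate`;
`l ≠ 0`: `bR_rate_alias`). [folklore] -/
theorem bR_rate_le (hN : 1 ≤ N) (hR : 1 ≤ R) (a : ℝ) (ha : 0 < a) {s : Fin d → ℝ}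
    (hs : ∀ ν, |s ν| ≤ Real.pi) (ν₀ : Fin d) (hν₀ : s ν₀ ≠ 0) (μ : Fin d) (k : Fin d → Fin N) :
    ‖bR N a μ (symmAlias N k s) s - bR (R * N) a μ (symmAlias N k s) s‖ ≤ be N a s k * bM N a s μ k := by
  unfold be bM
  split_ifs with hk
  · rw [hk, symmAlias_zero hN hs]
    exact bR_zero_rate hN hR a ha μ hs (ne_zero_of_apply hν₀)
  · have hr := isRep_symmAlias hN k hs
    exact bR_rate_alias hN hR a ha μ hs ν₀ hν₀ hr.zone hr.exists_int

/-- the constant of `Σ_l bM` : `π·MrS + CBa·C(d, −1)`. [folklore] -/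
def SB (d : ℕ) (a : ℝ) : ℝ := Real.pi * MrS d a + CBa d * aliasConst d (-1)

/-- the constant of `Σ_l be·bM` (times `N`). [folklore] -/
def SBe (d : ℕ) (a : ℝ) : ℝ :=
  ((1 + (Real.pi / 2) ^ (d + 1)) * (d * Real.pi) + CrS d a (4 * d) / MrS d a) * (Real.pi * MrS d a)
    + (B5G183Rate.Ab d * d + Bb d) * CBa d * aliasConst d 0

/-- the constant of the unpaired bracket sum (times `N`): `CBa·C(d, 0)/π`. [folklore] -/
def SBu (d : ℕ) : ℝ := CBa d * aliasConst d 0 / Real.pi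

omit [NeZero N] [NeZero R] in
/-- nonnegativity of the bracket constants. [folklore] -/
theorem b_consts_nonneg (hd : 0 < d) {a : ℝ} (ha : 0 < a) : 0 ≤ SB d a ∧ 0 ≤ SBe d a ∧ 0 ≤ SBu d := by
  have hg := T4GaugeActionRate.gam0_pos d
  have h1 := aliasConst_nonneg hd (β := -1) (by norm_num)
  have h0 := aliasConst_nonneg hd (β := 0) (by norm_num)
  have hC := CBa_nonneg d
  have hM := MrS_pos d ha
  have hCr := (CrS_nonneg_mono d ha (by positivity : (0 : ℝ) ≤ 4 * d) le_rfl).1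
  have hA : 0 ≤ B5G183Rate.Ab d := by unfold B5G183Rate.Ab; positivity
  have hB : 0 ≤ Bb d := by
    unfold Bb; have := B5ActionRate166.Cphi_pos; have := B5ActionRate166.Cpsi_pos; positivity
  refine ⟨?_, ?_, ?_⟩
  · unfold SB; positivity
  · unfold SBe; positivity
  · unfold SBu; positivity

/-- `bM_k ≤ CBa·aliasTerm(−1)(jOf k)` for `k ≠ 0`. [folklore] -/
theorem bM_le_aliasTerm (hN : 1 ≤ N) (a : ℝ) {s : Fin d → ℝ} (hs : ∀ ν, |s ν| ≤ Real.pi) (μ : Fin d)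
    {k : Fin d → Fin N} (hk : jOf N k s ≠ 0) : bM N a s μ k ≤ CBa d * aliasTerm (-1) s (jOf N k s) := by
  have hk' : k ≠ 0 := fun h => hk ((jOf_eq_zero_iff hN hs k).mpr h)
  have hx : 0 < ‖aliasPt s (jOf N k s)‖ := lt_of_lt_of_le Real.pi_pos (pi_le_norm_aliasPt hs hk)
  unfold bM
  rw [if_neg hk', symmAlias_eq_aliasPt]
  refine (bMajA_alias_le hs hk μ).trans_eq ?_
  unfold King1986.aliasTerm
  rw [mul_div_assoc, div_sq_eq_rpow hx]

/-- `be_k·bM_k ≤ ((Ab·d + Bb)·CBa/N)·aliasTerm(0)(jOf k)` for `k ≠ 0` (`N⁻² ≤ ‖q‖/N` as `‖q‖ ≥ π ≥ 1`).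
[folklore] -/
theorem be_bM_le_aliasTerm (hN : 1 ≤ N) (a : ℝ) {s : Fin d → ℝ} (hs : ∀ ν, |s ν| ≤ Real.pi) (μ : Fin d)
    {k : Fin d → Fin N} (hk : jOf N k s ≠ 0) :
    be N a s k * bM N a s μ k ≤ (B5G183Rate.Ab d * d + Bb d) * CBa d / N * aliasTerm 0 s (jOf N k s) := by
  have hN1 : (1 : ℝ) ≤ N := by exact_mod_cast hN
  have hN0 : (0 : ℝ) < N := by linarith
  have hk' : k ≠ 0 := fun h => hk ((jOf_eq_zero_iff hN hs k).mpr h)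
  set j := jOf N k s with hj
  have hq : symmAlias N k s = aliasPt s j := by rw [symmAlias_eq_aliasPt]
  have hxπ : Real.pi ≤ ‖aliasPt s j‖ := pi_le_norm_aliasPt hs hk
  have hx1 : 1 ≤ ‖aliasPt s j‖ := le_trans (by linarith [Real.pi_gt_three]) hxπ
  have hx : 0 < ‖aliasPt s j‖ := by linarith
  have hw := aliasWeight_nonneg s j
  have hA : 0 ≤ B5G183Rate.Ab d := by unfold B5G183Rate.Ab; positivity
  have hB : 0 ≤ Bb d := by
    unfold Bb; have := B5ActionRate166.Cphi_pos; have := B5ActionRate166.Cpsi_pos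
    have := T4GaugeActionRate.gam0_pos d; positivity
  have hC := CBa_nonneg d
  -- the coefficient: `Ab|q|₁/N + Bb/N² ≤ (B5G183Rate.Ab d + Bb)·‖q‖/N`
  have hcoef : B5G183Rate.Ab d * ((∑ ν, |aliasPt s j ν|) / N) + Bb d * ((N : ℝ) ^ 2)⁻¹
      ≤ (B5G183Rate.Ab d * d + Bb d) * (‖aliasPt s j‖ / N) := by
    have h1 : (∑ ν, |aliasPt s j ν|) / N ≤ d * (‖aliasPt s j‖ / N) := by
      rw [mul_div_assoc']
      exact div_le_div_of_nonneg_right (sum_abs_le_norm _) hN0.le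
    have h2 : ((N : ℝ) ^ 2)⁻¹ ≤ ‖aliasPt s j‖ / N := by
      rw [le_div_iff₀ hN0]
      calc ((N : ℝ) ^ 2)⁻¹ * N = (N : ℝ)⁻¹ := by field_simp
        _ ≤ 1 := inv_le_one_of_one_le₀ hN1
        _ ≤ ‖aliasPt s j‖ := hx1
    calc B5G183Rate.Ab d * ((∑ ν, |aliasPt s j ν|) / N) + Bb d * ((N : ℝ) ^ 2)⁻¹
        ≤ B5G183Rate.Ab d * (d * (‖aliasPt s j‖ / N)) + Bb d * (‖aliasPt s j‖ / N) := by gcongr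
      _ = (B5G183Rate.Ab d * d + Bb d) * (‖aliasPt s j‖ / N) := by ring
  have hbM : bM N a s μ k ≤ CBa d * aliasWeight s j / ‖aliasPt s j‖ ^ 2 := by
    unfold bM; rw [if_neg hk', hq]; exact bMajA_alias_le hs hk μ
  have hbM0 : 0 ≤ bM N a s μ k := by
    unfold bM; rw [if_neg hk']; exact bMajA_nonneg _ _ _
  unfold be
  rw [if_neg hk', hq]
  calc (B5G183Rate.Ab d * ((∑ ν, |aliasPt s j ν|) / N) + Bb d * ((N : ℝ) ^ 2)⁻¹) * bM N a s μ k
      ≤ ((B5G183Rate.Ab d * d + Bb d) * (‖aliasPt s j‖ / N)) * (CBa d * aliasWeight s j / ‖aliasPt s j‖ ^ 2) :=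
        mul_le_mul hcoef hbM hbM0 (by positivity)
    _ = (B5G183Rate.Ab d * d + Bb d) * CBa d / N * (‖aliasPt s j‖ * (aliasWeight s j / ‖aliasPt s j‖ ^ 2)) := by
        field_simp
    _ = (B5G183Rate.Ab d * d + Bb d) * CBa d / N * aliasTerm 0 s j := by rw [mul_div_sq_eq_rpow hx]; rfl

/-- **`Σ_l bM ≤ SB`**, zone centre included. [cite: King1986, (4.22) p.672] [folklore] -/
theorem sum_bM_le (hN : 1 ≤ N) (a : ℝ) (ha : 0 < a) {s : Fin d → ℝ} (hs : ∀ ν, |s ν| ≤ Real.pi)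
    (ν₀ : Fin d) (μ : Fin d) : ∑ k : Fin d → Fin N, bM N a s μ k ≤ SB d a := by
  have hd : 0 < d := Fin.pos ν₀
  have hπ := Real.pi_pos
  have hM := MrS_pos d ha
  unfold SB
  refine sum_le_of_alias_bound hd (β := -1) (by norm_num) hs _ (by positivity) (CBa_nonneg d)
    (fun k hk => ?_) (fun k hk => bM_le_aliasTerm hN a hs μ hk)
  rw [(jOf_eq_zero_iff hN hs k).mp hk]
  unfold bM
  rw [if_pos rfl]
  exact mul_le_mul_of_nonneg_right (hs μ) hM.le

/-- **`Σ_l be·bM ≤ SBe/N`**, zone centre included (`N⁻² ≤ N⁻¹`, `CrS(Δ₀) ≤ CrS(4d)`). [folklore] -/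
theorem sum_be_bM_le (hN : 1 ≤ N) (a : ℝ) (ha : 0 < a) {s : Fin d → ℝ} (hs : ∀ ν, |s ν| ≤ Real.pi)
    (ν₀ : Fin d) (hν₀ : s ν₀ ≠ 0) (μ : Fin d) : ∑ k : Fin d → Fin N, be N a s k * bM N a s μ k ≤ SBe d a / N := by
  have hd : 0 < d := Fin.pos ν₀
  have hπ := Real.pi_pos
  have hN1 : (1 : ℝ) ≤ N := by exact_mod_cast hN
  have hN0 : (0 : ℝ) < N := by linarith
  have hM := MrS_pos d ha
  have hD0 : 0 < Delta1r 0 s := Delta1r_pos s hs ν₀ hν₀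
  have hD4 : Delta1r 0 s ≤ 4 * d := Delta1r_le s
  obtain ⟨hCr0, hCrm⟩ := CrS_nonneg_mono d ha hD0.le hD4
  have hCr4 : 0 ≤ CrS d a (4 * d) := hCr0.trans hCrm
  have hA : 0 ≤ B5G183Rate.Ab d := by unfold B5G183Rate.Ab; positivity
  have hB : 0 ≤ Bb d := by
    unfold Bb; have := B5ActionRate166.Cphi_pos; have := B5ActionRate166.Cpsi_pos
    have := T4GaugeActionRate.gam0_pos d; positivity
  have hC := CBa_nonneg d
  have e : SBe d a / N
      = ((1 + (Real.pi / 2) ^ (d + 1)) * (d * Real.pi) + CrS d a (4 * d) / MrS d a) * (Real.pi * MrS d a) / N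
        + (B5G183Rate.Ab d * d + Bb d) * CBa d / N * aliasConst d 0 := by
    unfold SBe; field_simp
  rw [e]
  refine sum_le_of_alias_bound hd (β := 0) (by norm_num) hs _ (by positivity) (by positivity)
    (fun k hk => ?_) (fun k hk => be_bM_le_aliasTerm hN a hs μ hk)
  rw [(jOf_eq_zero_iff hN hs k).mp hk]
  unfold be bM
  rw [if_pos rfl, if_pos rfl]
  have h1 : (∑ ν, |s ν|) / N ≤ d * Real.pi / N :=
    div_le_div_of_nonneg_right ((sum_abs_le_norm s).trans (by gcongr; exact norm_le_pi hs)) hN0.le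
  have h2 : CrS d a (Delta1r 0 s) / MrS d a * ((N : ℝ) ^ 2)⁻¹ ≤ CrS d a (4 * d) / MrS d a / N := by
    rw [div_eq_mul_inv _ (N : ℝ)]
    refine mul_le_mul (div_le_div_of_nonneg_right hCrm hM.le) ?_ (by positivity) (by positivity)
    calc ((N : ℝ) ^ 2)⁻¹ = (N : ℝ)⁻¹ * (N : ℝ)⁻¹ := by rw [sq, mul_inv]
      _ ≤ (N : ℝ)⁻¹ * 1 := by gcongr; exact inv_le_one_of_one_le₀ hN1
      _ = (N : ℝ)⁻¹ := mul_one _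
  have h3 : |s μ| * MrS d a ≤ Real.pi * MrS d a := mul_le_mul_of_nonneg_right (hs μ) hM.le
  calc ((1 + (Real.pi / 2) ^ (d + 1)) * ((∑ ν, |s ν|) / N)
          + CrS d a (Delta1r 0 s) / MrS d a * ((N : ℝ) ^ 2)⁻¹) * (|s μ| * MrS d a)
      ≤ ((1 + (Real.pi / 2) ^ (d + 1)) * (d * Real.pi / N) + CrS d a (4 * d) / MrS d a / N)
          * (Real.pi * MrS d a) := by
        gcongr
    _ = ((1 + (Real.pi / 2) ^ (d + 1)) * (d * Real.pi) + CrS d a (4 * d) / MrS d a) * (Real.pi * MrS d a)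
          / N := by
        field_simp

/-- **the UNPAIRED level-`RN` bracket classes**: `Σ_{k″ unpaired} bM_{k″} ≤ SBu/N`. [cite: King1986, (4.23)
p.672] [folklore] -/
theorem sum_bM_unpaired_le (hN : 1 ≤ N) (hR : 1 ≤ R) (a : ℝ) {s : Fin d → ℝ} (hs : ∀ ν, |s ν| ≤ Real.pi)
    (ν₀ : Fin d) (μ : Fin d) :
    ∑ k'' ∈ Finset.univ.filter (fun k'' => ∀ k : Fin d → Fin N, iota R k s ≠ k''), bM (R * N) a s μ k''
      ≤ SBu d / N := by
  classical
  have hd : 0 < d := Fin.pos ν₀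
  have hπ := Real.pi_pos
  have hN0 : (0 : ℝ) < N := by exact_mod_cast hN
  have hRN : 1 ≤ R * N := one_le_RN hN hR
  have hC := CBa_nonneg d
  have e : SBu d / N = CBa d * (Real.pi * N)⁻¹ * aliasConst d 0 := by unfold SBu; field_simp
  rw [e]
  refine sum_le_of_alias_bound' hd (β := 0) (by norm_num) hs _ _ (by positivity) (fun k'' hk'' => ?_)
    (fun k'' hk'' => ?_)
  · simp only [Finset.mem_filter, Finset.mem_univ, true_and] at hk''
    exact jOf_ne_zero_of_unpaired hN hs hk''
  · simp only [Finset.mem_filter, Finset.mem_univ, true_and] at hk''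
    have hj0 := jOf_ne_zero_of_unpaired hN hs hk''
    have hk0 : k'' ≠ 0 := fun h => hj0 ((jOf_eq_zero_iff hRN hs k'').mpr h)
    set j := jOf (R * N) k'' s with hj
    have hq : symmAlias (R * N) k'' s = aliasPt s j := by rw [symmAlias_eq_aliasPt]
    have hfar : Real.pi * N ≤ ‖aliasPt s j‖ := by rw [← hq]; exact norm_ge_of_unpaired hN hs hk''
    have hw := aliasWeight_nonneg s j
    unfold bM
    rw [if_neg hk0, hq]
    calc bMajA d s (aliasPt s j) μ ≤ CBa d * aliasWeight s j / ‖aliasPt s j‖ ^ 2 := bMajA_alias_le hs hj0 μ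
      _ = CBa d * (aliasWeight s j / ‖aliasPt s j‖ ^ 2) := mul_div_assoc _ _ _
      _ ≤ CBa d * (‖aliasPt s j‖ ^ ((0 : ℝ) - 1) * aliasWeight s j * (Real.pi * N)⁻¹) :=
          mul_le_mul_of_nonneg_left (div_sq_le_rpow_mul_inv (by positivity) hfar hw) hC
      _ = CBa d * (Real.pi * N)⁻¹ * aliasTerm 0 s j := by unfold King1986.aliasTerm; ring

end Single

/-! ## §3 The x-block of (1.83): `ℓ¹` bounds and the η-rate of its alias double sums

The second term of (1.83) has the fibre entries `(aφ_μ(p′))⁻¹·x_μ(q_l)·conj(x_μ(q_{l′}))`, `l, l′ ∈ ℤ^d`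
(on the torus: `l, l′ ∈ (ℤ/n)^d`).  The entry `(0,0)` is NOT part of this block (it is regrouped with the free
diagonal into `dZ` of (1.87), module `B5G183Rate`); every other entry is summable in both indices. -/

section XBlock

variable {N R : ℕ} [NeZero N] [NeZero R]

/-- the x-block entry of (1.83) at U = 1 for the pair of classes `(k, k′)`:
`cX·xP_μ(q_k)·conj(xP_μ(q_{k′}))`. [cite: Balaban1984PropagatorsI, (1.83) p.31] [folklore] -/
def xEnt (n : ℕ) [NeZero n] (a : ℝ) (μ : Fin d) (s : Fin d → ℝ) (k k' : Fin d → Fin n) : ℂ :=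
  ((cX n a μ s : ℝ) : ℂ) * xP n μ (symmAlias n k s) * conj (xP n μ (symmAlias n k' s))

/-- the `N⁻²`-coefficient of the x-entry rate: `4d·Cφ/γ₀`. [folklore] -/
def rhoX (d : ℕ) : ℝ := 4 * d * Cphi / T4GaugeActionRate.gam0 d

omit [NeZero R] in
/-- `‖xEnt(k,k′)‖ ≤ cX·xM_k·xM_{k′}`. [folklore] -/
theorem norm_xEnt_le (hN : 1 ≤ N) (a : ℝ) (ha : 0 < a) (μ : Fin d) {s : Fin d → ℝ}
    (hs : ∀ ν, |s ν| ≤ Real.pi) (ν₀ : Fin d) (hν₀ : s ν₀ ≠ 0) (k k' : Fin d → Fin N) :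
    ‖xEnt N a μ s k k'‖ ≤ cX N a μ s * xM N s μ k * xM N s μ k' := by
  have hc := cX_pos (n := N) a ha μ s
  unfold xEnt
  rw [norm_mul, norm_mul, Complex.norm_conj, Complex.norm_real, Real.norm_eq_abs, abs_of_pos hc]
  exact mul_le_mul (mul_le_mul_of_nonneg_left (norm_xP_le_xM hN le_rfl hN hs ν₀ hν₀ μ k) hc.le)
    (norm_xP_le_xM hN le_rfl hN hs ν₀ hν₀ μ k') (norm_nonneg _)
    (mul_nonneg hc.le (xM_nonneg _ _ _))

/-- the per-entry η-rate of the x-block in the per-class currency: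
`‖xEnt^{(N)}(k,k′) − xEnt^{(RN)}(ιk, ιk′)‖ ≤ (ρX·N⁻² + xe_k + xe_{k′})·((Δ₀/γ₀)·xM_k·xM_{k′})`.
[cite: Balaban1984PropagatorsI, (1.83)/(1.85) pp.31–32; King1986, (4.29)–(4.31) p.673] [folklore] -/
theorem xEnt_rate_le (hN : 1 ≤ N) (hR : 1 ≤ R) (a : ℝ) (ha : 0 < a) (μ : Fin d) {s : Fin d → ℝ}
    (hs : ∀ ν, |s ν| ≤ Real.pi) (ν₀ : Fin d) (hν₀ : s ν₀ ≠ 0) (k k' : Fin d → Fin N) :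
    ‖xEnt N a μ s k k' - xEnt (R * N) a μ s (iota R k s) (iota R k' s)‖
      ≤ (rhoX d * ((N : ℝ) ^ 2)⁻¹ + xe N s k + xe N s k')
          * (Delta1r 0 s / T4GaugeActionRate.gam0 d * xM N s μ k * xM N s μ k') := by
  have hr := isRep_symmAlias hN k hs
  have hr' := isRep_symmAlias hN k' hs
  unfold xEnt
  rw [symmAlias_iota hN k hs, symmAlias_iota hN k' hs]
  exact xEntry_rate hN hR a ha μ hs ν₀ hν₀ hr.zone hr.exists_int hr'.zone hr'.exists_int

omit [NeZero R] in
/-- `Σ_l cX·xM_l ≤ KX`. [folklore] -/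
theorem sum_cX_xM_le (hN : 1 ≤ N) (a : ℝ) (ha : 0 < a) (μ : Fin d) {s : Fin d → ℝ}
    (hs : ∀ ν, |s ν| ≤ Real.pi) (ν₀ : Fin d) (hν₀ : s ν₀ ≠ 0) :
    ∑ k : Fin d → Fin N, cX N a μ s * xM N s μ k ≤ KX d :=
  (Finset.sum_le_sum fun _ _ =>
      mul_le_mul_of_nonneg_right (cX_le hN a ha μ hs ν₀ hν₀) (xM_nonneg _ _ _)).trans
    (sum_D0_xM_le hN hs ν₀ hν₀ μ)

omit [NeZero R] in
/-- the zone-centre factor: `cX·xM_0 = cX·D(p′) ≤ π²/(4γ₀)`. [folklore] -/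
theorem cX_xM_zero_le (hN : 1 ≤ N) (a : ℝ) (ha : 0 < a) (μ : Fin d) {s : Fin d → ℝ}
    (hs : ∀ ν, |s ν| ≤ Real.pi) (ν₀ : Fin d) (hν₀ : s ν₀ ≠ 0) :
    cX N a μ s * xM N s μ 0 ≤ Real.pi ^ 2 / 4 / T4GaugeActionRate.gam0 d := by
  have hg := T4GaugeActionRate.gam0_pos d
  unfold xM
  rw [symmAlias_zero hN hs, xMaj_self]
  calc cX N a μ s * Dq s ≤ Delta1r 0 s / T4GaugeActionRate.gam0 d * Dq s :=
        mul_le_mul_of_nonneg_right (cX_le hN a ha μ hs ν₀ hν₀) (Dq_nonneg s)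
    _ = Delta1r 0 s * Dq s / T4GaugeActionRate.gam0 d := by ring
    _ ≤ Real.pi ^ 2 / 4 / T4GaugeActionRate.gam0 d :=
        div_le_div_of_nonneg_right (Delta1r_mul_Dq_le hs ν₀ hν₀) hg.le

omit [NeZero R] in
/-- the zone-centre factor in the rate currency: `(Δ₀/γ₀)·xM_0 ≤ π²/(4γ₀)`. [folklore] -/
theorem D0_xM_zero_le (hN : 1 ≤ N) (μ : Fin d) {s : Fin d → ℝ} (hs : ∀ ν, |s ν| ≤ Real.pi) (ν₀ : Fin d)
    (hν₀ : s ν₀ ≠ 0) :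
    Delta1r 0 s / T4GaugeActionRate.gam0 d * xM N s μ 0 ≤ Real.pi ^ 2 / 4 / T4GaugeActionRate.gam0 d := by
  have hg := T4GaugeActionRate.gam0_pos d
  unfold xM
  rw [symmAlias_zero hN hs, xMaj_self, div_mul_eq_mul_div]
  exact div_le_div_of_nonneg_right (Delta1r_mul_Dq_le hs ν₀ hν₀) hg.le

omit [NeZero R] in
/-- **x-block, uniform `ℓ¹` bound, rows `l ≠ 0`:** `Σ_{l ≠ 0} Σ_{l′} ‖xEnt(l,l′)‖ ≤ SX·KX`, uniformly in the
lattice spacing and in `p′ ≠ 0`. [cite: Balaban1984PropagatorsI, p.32 («this expression defines a bounded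
operator on L²(T_η)»)] [folklore] -/
theorem xBlock_rows_le (hN : 1 ≤ N) (a : ℝ) (ha : 0 < a) (μ : Fin d) {s : Fin d → ℝ}
    (hs : ∀ ν, |s ν| ≤ Real.pi) (ν₀ : Fin d) (hν₀ : s ν₀ ≠ 0) :
    ∑ k ∈ Finset.univ.erase (0 : Fin d → Fin N), ∑ k' : Fin d → Fin N, ‖xEnt N a μ s k k'‖
      ≤ SX d * KX d := by
  have hd : 0 < d := Fin.pos ν₀
  have hc := cX_pos (n := N) a ha μ s
  calc ∑ k ∈ Finset.univ.erase (0 : Fin d → Fin N), ∑ k' : Fin d → Fin N, ‖xEnt N a μ s k k'‖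
      ≤ 1 * (∑ k ∈ Finset.univ.erase (0 : Fin d → Fin N), xM N s μ k)
          * ∑ k' : Fin d → Fin N, cX N a μ s * xM N s μ k' :=
        sum_sum_le_of_le_mul _ _
          (fun k _ k' _ => (norm_xEnt_le hN a ha μ hs ν₀ hν₀ k k').trans_eq (by ring))
    _ ≤ 1 * SX d * KX d :=
        mul_le_mul (mul_le_mul_of_nonneg_left (sum_xM_ne_le hN hs ν₀ μ) zero_le_one)
          (sum_cX_xM_le hN a ha μ hs ν₀ hν₀) (Finset.sum_nonneg fun k' _ => mul_nonneg hc.le (xM_nonneg _ _ _))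
          (by have := (x_consts_nonneg (d := d) hd).1; positivity)
    _ = SX d * KX d := by ring

omit [NeZero R] in
/-- **x-block, uniform `ℓ¹` bound, row `l = 0` (entries `l′ ≠ 0`):** `Σ_{l′ ≠ 0} ‖xEnt(0,l′)‖ ≤ (π²/(4γ₀))·SX`.
[folklore] -/
theorem xBlock_row0_le (hN : 1 ≤ N) (a : ℝ) (ha : 0 < a) (μ : Fin d) {s : Fin d → ℝ}
    (hs : ∀ ν, |s ν| ≤ Real.pi) (ν₀ : Fin d) (hν₀ : s ν₀ ≠ 0) :
    ∑ k' ∈ Finset.univ.erase (0 : Fin d → Fin N), ‖xEnt N a μ s 0 k'‖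
      ≤ Real.pi ^ 2 / 4 / T4GaugeActionRate.gam0 d * SX d := by
  have hg := T4GaugeActionRate.gam0_pos d
  have h0 := cX_xM_zero_le hN a ha μ hs ν₀ hν₀
  calc ∑ k' ∈ Finset.univ.erase (0 : Fin d → Fin N), ‖xEnt N a μ s 0 k'‖
      ≤ ∑ k' ∈ Finset.univ.erase (0 : Fin d → Fin N), Real.pi ^ 2 / 4 / T4GaugeActionRate.gam0 d * xM N s μ k' :=
        Finset.sum_le_sum fun k' _ => (norm_xEnt_le hN a ha μ hs ν₀ hν₀ 0 k').trans
          (mul_le_mul_of_nonneg_right h0 (xM_nonneg _ _ _))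
    _ ≤ Real.pi ^ 2 / 4 / T4GaugeActionRate.gam0 d * SX d := by
        rw [← Finset.mul_sum]
        exact mul_le_mul_of_nonneg_left (sum_xM_ne_le hN hs ν₀ μ) (by positivity)

/-- the constant of the paired x-block rate, rows `l ≠ 0` (times `N`). [folklore] -/
def CXr (d : ℕ) : ℝ := rhoX d * SX d * KX d + SXe d * KX d + SX d * KXe d

/-- the constant of the paired x-block rate, row `l = 0` (times `N`). [folklore] -/
def CX0r (d : ℕ) : ℝ :=
  Real.pi ^ 2 / 4 / T4GaugeActionRate.gam0 d * ((rhoX d + Ax d * (d * Real.pi)) * SX d + SXe d)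

omit [NeZero N] [NeZero R] in
/-- `N⁻² ≤ N⁻¹` for `N ≥ 1`, with a nonnegative factor. [folklore] -/
theorem mul_inv_sq_le_div {c : ℝ} (hc : 0 ≤ c) (hN : 1 ≤ N) : c * ((N : ℝ) ^ 2)⁻¹ ≤ c / N := by
  have hN1 : (1 : ℝ) ≤ N := by exact_mod_cast hN
  rw [div_eq_mul_inv]
  refine mul_le_mul_of_nonneg_left ?_ hc
  calc ((N : ℝ) ^ 2)⁻¹ = (N : ℝ)⁻¹ * (N : ℝ)⁻¹ := by rw [sq, mul_inv]
    _ ≤ (N : ℝ)⁻¹ * 1 := by gcongr; exact inv_le_one_of_one_le₀ hN1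
    _ = (N : ℝ)⁻¹ := mul_one _

/-- **x-block, η-RATE of the PAIRED alias double sum, rows `l ≠ 0`:**
`Σ_{k ≠ 0} Σ_{k′} ‖xEnt^{(N)}(k,k′) − xEnt^{(RN)}(ιk, ιk′)‖ ≤ CXr/N` — King's pairing `l = l′ + kL^K`
applied to both alias indices of Bałaban's (1.83), each paired difference rated by `xEnt_rate_le` and the
three resulting sums bounded by (4.22) with `β = −1, 0`. [cite: King1986, (4.19)–(4.24) p.672;
Balaban1984PropagatorsI, (1.83) p.31, p.32] [folklore] -/
theorem xBlock_rows_rate (hN : 1 ≤ N) (hR : 1 ≤ R) (a : ℝ) (ha : 0 < a) (μ : Fin d) {s : Fin d → ℝ}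
    (hs : ∀ ν, |s ν| ≤ Real.pi) (ν₀ : Fin d) (hν₀ : s ν₀ ≠ 0) :
    ∑ k ∈ Finset.univ.erase (0 : Fin d → Fin N), ∑ k' : Fin d → Fin N,
        ‖xEnt N a μ s k k' - xEnt (R * N) a μ s (iota R k s) (iota R k' s)‖ ≤ CXr d / N := by
  have hd : 0 < d := Fin.pos ν₀
  have hN0 : (0 : ℝ) < N := by exact_mod_cast hN
  have hg := T4GaugeActionRate.gam0_pos d
  have hD0 : 0 < Delta1r 0 s := Delta1r_pos s hs ν₀ hν₀
  obtain ⟨hSX, hSXe, hKX, hKXe, -⟩ := x_consts_nonneg (d := d) hd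
  have hρ : 0 ≤ rhoX d := by unfold rhoX; have := B5ActionRate166.Cphi_pos; positivity
  have hK0 : 0 ≤ Delta1r 0 s / T4GaugeActionRate.gam0 d := by positivity
  -- the single sums
  have hF : ∑ k ∈ Finset.univ.erase (0 : Fin d → Fin N), xM N s μ k ≤ SX d := sum_xM_ne_le hN hs ν₀ μ
  have hFe : ∑ k ∈ Finset.univ.erase (0 : Fin d → Fin N), xe N s k * xM N s μ k ≤ SXe d / N :=
    sum_xe_xM_ne_le hN hs ν₀ μ
  have hG : Delta1r 0 s / T4GaugeActionRate.gam0 d * ∑ k' : Fin d → Fin N, xM N s μ k' ≤ KX d := by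
    rw [Finset.mul_sum]; exact sum_D0_xM_le hN hs ν₀ hν₀ μ
  have hGe : Delta1r 0 s / T4GaugeActionRate.gam0 d * ∑ k' : Fin d → Fin N, xe N s k' * xM N s μ k'
      ≤ KXe d / N := by
    rw [Finset.mul_sum]; exact sum_D0_xe_xM_le hN hs ν₀ hν₀ μ
  have hF0 : 0 ≤ ∑ k ∈ Finset.univ.erase (0 : Fin d → Fin N), xM N s μ k :=
    Finset.sum_nonneg fun k _ => xM_nonneg _ _ _
  have hFe0 : 0 ≤ ∑ k ∈ Finset.univ.erase (0 : Fin d → Fin N), xe N s k * xM N s μ k :=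
    Finset.sum_nonneg fun k _ => mul_nonneg (xe_nonneg _ _) (xM_nonneg _ _ _)
  have hG0 : 0 ≤ Delta1r 0 s / T4GaugeActionRate.gam0 d * ∑ k' : Fin d → Fin N, xM N s μ k' :=
    mul_nonneg hK0 (Finset.sum_nonneg fun k _ => xM_nonneg _ _ _)
  have hGe0 : 0 ≤ Delta1r 0 s / T4GaugeActionRate.gam0 d * ∑ k' : Fin d → Fin N, xe N s k' * xM N s μ k' :=
    mul_nonneg hK0 (Finset.sum_nonneg fun k _ => mul_nonneg (xe_nonneg _ _) (xM_nonneg _ _ _))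
  have hρN : rhoX d * ((N : ℝ) ^ 2)⁻¹ ≤ rhoX d / N := mul_inv_sq_le_div hρ hN
  have h := sum_sum_rate_le (Finset.univ.erase (0 : Fin d → Fin N)) Finset.univ
    (ρ := rhoX d * ((N : ℝ) ^ 2)⁻¹) (K := Delta1r 0 s / T4GaugeActionRate.gam0 d)
    (E := fun k k' => ‖xEnt N a μ s k k' - xEnt (R * N) a μ s (iota R k s) (iota R k' s)‖)
    (F := fun k => xM N s μ k) (G := fun k' => xM N s μ k') (ε := fun k => xe N s k) (ε' := fun k' => xe N s k')
    (fun k _ k' _ => (xEnt_rate_le hN hR a ha μ hs ν₀ hν₀ k k').trans_eq (by ring))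
  refine h.trans ?_
  calc Delta1r 0 s / T4GaugeActionRate.gam0 d
          * (rhoX d * ((N : ℝ) ^ 2)⁻¹ * (∑ k ∈ Finset.univ.erase (0 : Fin d → Fin N), xM N s μ k)
              * (∑ k' : Fin d → Fin N, xM N s μ k')
            + (∑ k ∈ Finset.univ.erase (0 : Fin d → Fin N), xe N s k * xM N s μ k)
              * (∑ k' : Fin d → Fin N, xM N s μ k')
            + (∑ k ∈ Finset.univ.erase (0 : Fin d → Fin N), xM N s μ k)
              * ∑ k' : Fin d → Fin N, xe N s k' * xM N s μ k')
      = rhoX d * ((N : ℝ) ^ 2)⁻¹ * (∑ k ∈ Finset.univ.erase (0 : Fin d → Fin N), xM N s μ k)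
            * (Delta1r 0 s / T4GaugeActionRate.gam0 d * ∑ k' : Fin d → Fin N, xM N s μ k')
          + (∑ k ∈ Finset.univ.erase (0 : Fin d → Fin N), xe N s k * xM N s μ k)
            * (Delta1r 0 s / T4GaugeActionRate.gam0 d * ∑ k' : Fin d → Fin N, xM N s μ k')
          + (∑ k ∈ Finset.univ.erase (0 : Fin d → Fin N), xM N s μ k)
            * (Delta1r 0 s / T4GaugeActionRate.gam0 d * ∑ k' : Fin d → Fin N, xe N s k' * xM N s μ k') := by
        ring
    _ ≤ rhoX d / N * SX d * KX d + SXe d / N * KX d + SX d * (KXe d / N) := by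
        gcongr
    _ = CXr d / N := by unfold CXr; field_simp

/-- **x-block, η-RATE of the PAIRED alias sum, row `l = 0`:**
`Σ_{k′ ≠ 0} ‖xEnt^{(N)}(0,k′) − xEnt^{(RN)}(0, ιk′)‖ ≤ CX0r/N`. [folklore] -/
theorem xBlock_row0_rate (hN : 1 ≤ N) (hR : 1 ≤ R) (a : ℝ) (ha : 0 < a) (μ : Fin d) {s : Fin d → ℝ}
    (hs : ∀ ν, |s ν| ≤ Real.pi) (ν₀ : Fin d) (hν₀ : s ν₀ ≠ 0) :
    ∑ k' ∈ Finset.univ.erase (0 : Fin d → Fin N),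
        ‖xEnt N a μ s 0 k' - xEnt (R * N) a μ s (iota R 0 s) (iota R k' s)‖ ≤ CX0r d / N := by
  have hd : 0 < d := Fin.pos ν₀
  have hπ := Real.pi_pos
  have hN0 : (0 : ℝ) < N := by exact_mod_cast hN
  have hg := T4GaugeActionRate.gam0_pos d
  have hD0 : 0 < Delta1r 0 s := Delta1r_pos s hs ν₀ hν₀
  obtain ⟨hSX, hSXe, -, -, -⟩ := x_consts_nonneg (d := d) hd
  have hρ : 0 ≤ rhoX d := by unfold rhoX; have := B5ActionRate166.Cphi_pos; positivity
  have hA : 0 ≤ Ax d := by unfold Ax; positivity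
  have hK0 : 0 ≤ Delta1r 0 s / T4GaugeActionRate.gam0 d := by positivity
  have hF : ∑ k ∈ Finset.univ.erase (0 : Fin d → Fin N), xM N s μ k ≤ SX d := sum_xM_ne_le hN hs ν₀ μ
  have hFe : ∑ k ∈ Finset.univ.erase (0 : Fin d → Fin N), xe N s k * xM N s μ k ≤ SXe d / N :=
    sum_xe_xM_ne_le hN hs ν₀ μ
  have hF0 : 0 ≤ ∑ k ∈ Finset.univ.erase (0 : Fin d → Fin N), xM N s μ k :=
    Finset.sum_nonneg fun k _ => xM_nonneg _ _ _
  have hFe0 : 0 ≤ ∑ k ∈ Finset.univ.erase (0 : Fin d → Fin N), xe N s k * xM N s μ k :=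
    Finset.sum_nonneg fun k _ => mul_nonneg (xe_nonneg _ _) (xM_nonneg _ _ _)
  have hZ : Delta1r 0 s / T4GaugeActionRate.gam0 d * xM N s μ 0 ≤ Real.pi ^ 2 / 4 / T4GaugeActionRate.gam0 d :=
    D0_xM_zero_le hN μ hs ν₀ hν₀
  have hZ0 : 0 ≤ Delta1r 0 s / T4GaugeActionRate.gam0 d * xM N s μ 0 := mul_nonneg hK0 (xM_nonneg _ _ _)
  have he0 : xe N s 0 ≤ Ax d * (d * Real.pi) / N := by
    unfold xe
    rw [symmAlias_zero hN hs, mul_div_assoc]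
    exact mul_le_mul_of_nonneg_left
      (div_le_div_of_nonneg_right ((sum_abs_le_norm s).trans (by gcongr; exact norm_le_pi hs)) hN0.le) hA
  have he00 : 0 ≤ xe N s 0 := xe_nonneg _ _
  have hρN : rhoX d * ((N : ℝ) ^ 2)⁻¹ ≤ rhoX d / N := mul_inv_sq_le_div hρ hN
  have hin0 : 0 ≤ (rhoX d * ((N : ℝ) ^ 2)⁻¹ + xe N s 0)
      * (∑ k' ∈ Finset.univ.erase (0 : Fin d → Fin N), xM N s μ k')
      + ∑ k' ∈ Finset.univ.erase (0 : Fin d → Fin N), xe N s k' * xM N s μ k' :=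
    add_nonneg (mul_nonneg (add_nonneg (mul_nonneg hρ (by positivity)) he00) hF0) hFe0
  calc ∑ k' ∈ Finset.univ.erase (0 : Fin d → Fin N),
          ‖xEnt N a μ s 0 k' - xEnt (R * N) a μ s (iota R 0 s) (iota R k' s)‖
      ≤ ∑ k' ∈ Finset.univ.erase (0 : Fin d → Fin N), (Delta1r 0 s / T4GaugeActionRate.gam0 d * xM N s μ 0)
          * ((rhoX d * ((N : ℝ) ^ 2)⁻¹ + xe N s 0) * xM N s μ k' + xe N s k' * xM N s μ k') :=
        Finset.sum_le_sum fun k' _ => (xEnt_rate_le hN hR a ha μ hs ν₀ hν₀ 0 k').trans_eq (by ring)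
    _ = (Delta1r 0 s / T4GaugeActionRate.gam0 d * xM N s μ 0)
          * ((rhoX d * ((N : ℝ) ^ 2)⁻¹ + xe N s 0) * (∑ k' ∈ Finset.univ.erase (0 : Fin d → Fin N), xM N s μ k')
            + ∑ k' ∈ Finset.univ.erase (0 : Fin d → Fin N), xe N s k' * xM N s μ k') := by
        rw [← Finset.mul_sum, Finset.sum_add_distrib, ← Finset.mul_sum]
    _ ≤ Real.pi ^ 2 / 4 / T4GaugeActionRate.gam0 d
          * ((rhoX d / N + Ax d * (d * Real.pi) / N) * SX d + SXe d / N) :=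
        mul_le_mul hZ (add_le_add (mul_le_mul (add_le_add hρN he0) hF hF0 (by positivity)) hFe) hin0
          (by positivity)
    _ = CX0r d / N := by unfold CX0r; field_simp

/-- **x-block, the UNPAIRED level-`RN` rows:** `Σ_{k″ unpaired} Σ_{k‴} ‖xEnt^{(RN)}(k″,k‴)‖ ≤ SXu·KX/N`.
[cite: King1986, (4.23) p.672] [folklore] -/
theorem xBlock_unpaired_rows_le (hN : 1 ≤ N) (hR : 1 ≤ R) (a : ℝ) (ha : 0 < a) (μ : Fin d)
    {s : Fin d → ℝ} (hs : ∀ ν, |s ν| ≤ Real.pi) (ν₀ : Fin d) (hν₀ : s ν₀ ≠ 0) :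
    ∑ k'' ∈ Finset.univ.filter (fun k'' => ∀ k : Fin d → Fin N, iota R k s ≠ k''),
        ∑ l : Fin d → Fin (R * N), ‖xEnt (R * N) a μ s k'' l‖ ≤ SXu d * KX d / N := by
  have hd : 0 < d := Fin.pos ν₀
  have hN0 : (0 : ℝ) < N := by exact_mod_cast hN
  have hRN : 1 ≤ R * N := one_le_RN hN hR
  have hc := cX_pos (n := R * N) a ha μ s
  obtain ⟨-, -, hKX, -, hSXu⟩ := x_consts_nonneg (d := d) hd
  calc ∑ k'' ∈ Finset.univ.filter (fun k'' => ∀ k : Fin d → Fin N, iota R k s ≠ k''),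
          ∑ l : Fin d → Fin (R * N), ‖xEnt (R * N) a μ s k'' l‖
      ≤ 1 * (∑ k'' ∈ Finset.univ.filter (fun k'' => ∀ k : Fin d → Fin N, iota R k s ≠ k''),
            xM (R * N) s μ k'') * ∑ l : Fin d → Fin (R * N), cX (R * N) a μ s * xM (R * N) s μ l :=
        sum_sum_le_of_le_mul _ _
          (fun k _ k' _ => (norm_xEnt_le hRN a ha μ hs ν₀ hν₀ k k').trans_eq (by ring))
    _ ≤ 1 * (SXu d / N) * KX d :=
        mul_le_mul (mul_le_mul_of_nonneg_left (sum_xM_unpaired_le hN hs ν₀ μ) zero_le_one)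
          (sum_cX_xM_le hRN a ha μ hs ν₀ hν₀)
          (Finset.sum_nonneg fun k' _ => mul_nonneg hc.le (xM_nonneg _ _ _)) (by positivity)
    _ = SXu d * KX d / N := by ring

/-- **x-block, the UNPAIRED level-`RN` columns:** `Σ_{k″} Σ_{k‴ unpaired} ‖xEnt^{(RN)}(k″,k‴)‖ ≤ KX·SXu/N`.
[cite: King1986, (4.23) p.672] [folklore] -/
theorem xBlock_unpaired_cols_le (hN : 1 ≤ N) (hR : 1 ≤ R) (a : ℝ) (ha : 0 < a) (μ : Fin d)
    {s : Fin d → ℝ} (hs : ∀ ν, |s ν| ≤ Real.pi) (ν₀ : Fin d) (hν₀ : s ν₀ ≠ 0) :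
    ∑ l : Fin d → Fin (R * N),
        ∑ k'' ∈ Finset.univ.filter (fun k'' => ∀ k : Fin d → Fin N, iota R k s ≠ k''),
          ‖xEnt (R * N) a μ s l k''‖ ≤ KX d * SXu d / N := by
  have hd : 0 < d := Fin.pos ν₀
  have hN0 : (0 : ℝ) < N := by exact_mod_cast hN
  have hRN : 1 ≤ R * N := one_le_RN hN hR
  have hc := cX_pos (n := R * N) a ha μ s
  obtain ⟨-, -, hKX, -, hSXu⟩ := x_consts_nonneg (d := d) hd
  calc ∑ l : Fin d → Fin (R * N),
          ∑ k'' ∈ Finset.univ.filter (fun k'' => ∀ k : Fin d → Fin N, iota R k s ≠ k''),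
            ‖xEnt (R * N) a μ s l k''‖
      ≤ 1 * (∑ l : Fin d → Fin (R * N), cX (R * N) a μ s * xM (R * N) s μ l)
          * ∑ k'' ∈ Finset.univ.filter (fun k'' => ∀ k : Fin d → Fin N, iota R k s ≠ k''),
              xM (R * N) s μ k'' :=
        sum_sum_le_of_le_mul _ _
          (fun k _ k' _ => (norm_xEnt_le hRN a ha μ hs ν₀ hν₀ k k').trans_eq (by ring))
    _ ≤ 1 * KX d * (SXu d / N) :=
        mul_le_mul (mul_le_mul_of_nonneg_left (sum_cX_xM_le hRN a ha μ hs ν₀ hν₀) zero_le_one)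
          (sum_xM_unpaired_le hN hs ν₀ μ) (Finset.sum_nonneg fun k' _ => xM_nonneg _ _ _) (by positivity)
    _ = KX d * SXu d / N := by ring

end XBlock

/-! ## §4 The rank-one block of (1.83): `ℓ¹` bounds and the η-rate of its alias double sums

The third term of (1.83) has the fibre entries `cB·b(l,μ)·conj(b(l′,ν))`, ALL `l, l′` (the centre entries
`l = 0` / `l′ = 0` in the (1.88) form). -/

section RankOne

variable {N R : ℕ} [NeZero N] [NeZero R]

/-- the rank-one entry of (1.83) at U = 1 for the pair of classes `(k, k′)` and directions `(μ, ν)`: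
`cB·bR_μ(q_k)·conj(bR_ν(q_{k′}))`. [cite: Balaban1984PropagatorsI, (1.83) p.31, (1.88) p.32] [folklore] -/
def rEnt (n : ℕ) [NeZero n] (a : ℝ) (μ ν : Fin d) (s : Fin d → ℝ) (k k' : Fin d → Fin n) : ℂ :=
  ((cB n a s : ℝ) : ℂ) * bR n a μ (symmAlias n k s) s * conj (bR n a ν (symmAlias n k' s) s)

/-- the `N⁻²`-coefficient of the rank-one coefficient rate: `4d·Cφ/γ₀²`. [folklore] -/
def rhoB (d : ℕ) : ℝ := 4 * d * Cphi / T4GaugeActionRate.gam0 d ^ 2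

omit [NeZero R] in
/-- `‖rEnt(k,k′)‖ ≤ cB·bM_μ(k)·bM_ν(k′)`. [folklore] -/
theorem norm_rEnt_le (hN : 1 ≤ N) (a : ℝ) (ha : 0 < a) (μ ν : Fin d) {s : Fin d → ℝ}
    (hs : ∀ ν, |s ν| ≤ Real.pi) (ν₀ : Fin d) (hν₀ : s ν₀ ≠ 0) (k k' : Fin d → Fin N) :
    ‖rEnt N a μ ν s k k'‖ ≤ cB N a s * bM N a s μ k * bM N a s ν k' := by
  have hc := cB_pos hN a ha hs ν₀ hν₀
  unfold rEnt
  rw [norm_mul, norm_mul, Complex.norm_conj, Complex.norm_real, Real.norm_eq_abs, abs_of_pos hc]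
  exact mul_le_mul (mul_le_mul_of_nonneg_left (norm_bR_le_bM hN le_rfl hN a ha hs ν₀ hν₀ μ k) hc.le)
    (norm_bR_le_bM hN le_rfl hN a ha hs ν₀ hν₀ ν k') (norm_nonneg _)
    (mul_nonneg hc.le (bM_nonneg ha _ _ _))

/-- the per-entry η-rate of the rank-one block in the per-class currency:
`‖rEnt^{(N)}(k,k′) − rEnt^{(RN)}(ιk, ιk′)‖ ≤ (ρB·N⁻² + be_k + be_{k′})·((4d+a)/a·bM_μ(k)·bM_ν(k′))`.
[cite: Balaban1984PropagatorsI, (1.83) p.31, (1.88) p.32; King1986, (4.29)–(4.31) p.673] [folklore] -/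
theorem rEnt_rate_le (hN : 1 ≤ N) (hR : 1 ≤ R) (a : ℝ) (ha : 0 < a) (μ ν : Fin d) {s : Fin d → ℝ}
    (hs : ∀ ν, |s ν| ≤ Real.pi) (ν₀ : Fin d) (hν₀ : s ν₀ ≠ 0) (k k' : Fin d → Fin N) :
    ‖rEnt N a μ ν s k k' - rEnt (R * N) a μ ν s (iota R k s) (iota R k' s)‖
      ≤ (rhoB d * ((N : ℝ) ^ 2)⁻¹ + be N a s k + be N a s k')
          * ((4 * d + a) / a * bM N a s μ k * bM N a s ν k') := by
  have hRN : 1 ≤ R * N := one_le_RN hN hR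
  have hNRN : N ≤ R * N := Nat.le_mul_of_pos_left N (by omega)
  unfold rEnt
  rw [symmAlias_iota hN k hs, symmAlias_iota hN k' hs]
  exact rankOne_rate_of hN hR a ha hs ν₀ hν₀ (norm_bR_le_bM hN le_rfl hN a ha hs ν₀ hν₀ μ k)
    (norm_bR_le_bM hRN hNRN hN a ha hs ν₀ hν₀ μ k) (norm_bR_le_bM hRN hNRN hN a ha hs ν₀ hν₀ ν k')
    (bR_rate_le hN hR a ha hs ν₀ hν₀ μ k) (bR_rate_le hN hR a ha hs ν₀ hν₀ ν k') (be_nonneg ha hs ν₀ hν₀ k)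

omit [NeZero R] in
/-- **rank-one block, uniform `ℓ¹` bound:** `Σ_l Σ_{l′} ‖rEnt(l,l′)‖ ≤ ((4d+a)/a)·SB²`, uniformly in the lattice
spacing and in `p′ ≠ 0` (the printed «the third term is well defined by continuity at p′ = 0 and defines a
bounded operator»). [cite: Balaban1984PropagatorsI, p.32] [folklore] -/
theorem rBlock_le (hN : 1 ≤ N) (a : ℝ) (ha : 0 < a) (μ ν : Fin d) {s : Fin d → ℝ}
    (hs : ∀ ν, |s ν| ≤ Real.pi) (ν₀ : Fin d) (hν₀ : s ν₀ ≠ 0) :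
    ∑ k : Fin d → Fin N, ∑ k' : Fin d → Fin N, ‖rEnt N a μ ν s k k'‖ ≤ (4 * d + a) / a * SB d a * SB d a := by
  have hd : 0 < d := Fin.pos ν₀
  have hc := cB_pos hN a ha hs ν₀ hν₀
  obtain ⟨hc1, hc2⟩ := cB_le hN a ha hs ν₀ hν₀
  have hSB := (b_consts_nonneg hd ha).1
  calc ∑ k : Fin d → Fin N, ∑ k' : Fin d → Fin N, ‖rEnt N a μ ν s k k'‖
      ≤ cB N a s * (∑ k : Fin d → Fin N, bM N a s μ k) * ∑ k' : Fin d → Fin N, bM N a s ν k' :=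
        sum_sum_le_of_le_mul _ _
          (fun k _ k' _ => norm_rEnt_le hN a ha μ ν hs ν₀ hν₀ k k')
    _ ≤ (4 * d + a) / a * SB d a * SB d a :=
        mul_le_mul (mul_le_mul (hc1.trans hc2) (sum_bM_le hN a ha hs ν₀ μ)
            (Finset.sum_nonneg fun k _ => bM_nonneg ha _ _ _) (by positivity))
          (sum_bM_le hN a ha hs ν₀ ν) (Finset.sum_nonneg fun k _ => bM_nonneg ha _ _ _) (by positivity)

/-- the constant of the paired rank-one rate (times `N`). [folklore] -/
def CRr (d : ℕ) (a : ℝ) : ℝ := (4 * d + a) / a * (rhoB d * SB d a * SB d a + 2 * (SBe d a * SB d a))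

/-- **rank-one block, η-RATE of the PAIRED alias double sum:**
`Σ_k Σ_{k′} ‖rEnt^{(N)}(k,k′) − rEnt^{(RN)}(ιk, ιk′)‖ ≤ CRr/N`. [cite: King1986, (4.19)–(4.24) p.672;
Balaban1984PropagatorsI, (1.83) p.31, (1.88) p.32] [folklore] -/
theorem rBlock_rate (hN : 1 ≤ N) (hR : 1 ≤ R) (a : ℝ) (ha : 0 < a) (μ ν : Fin d) {s : Fin d → ℝ}
    (hs : ∀ ν, |s ν| ≤ Real.pi) (ν₀ : Fin d) (hν₀ : s ν₀ ≠ 0) :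
    ∑ k : Fin d → Fin N, ∑ k' : Fin d → Fin N,
        ‖rEnt N a μ ν s k k' - rEnt (R * N) a μ ν s (iota R k s) (iota R k' s)‖ ≤ CRr d a / N := by
  have hd : 0 < d := Fin.pos ν₀
  have hN0 : (0 : ℝ) < N := by exact_mod_cast hN
  obtain ⟨hSB, hSBe, -⟩ := b_consts_nonneg hd ha
  have hρ : 0 ≤ rhoB d := by
    unfold rhoB; have := B5ActionRate166.Cphi_pos; have := T4GaugeActionRate.gam0_pos d; positivity
  have hK0 : (0 : ℝ) ≤ (4 * d + a) / a := by positivity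
  have hF : ∑ k : Fin d → Fin N, bM N a s μ k ≤ SB d a := sum_bM_le hN a ha hs ν₀ μ
  have hG : ∑ k : Fin d → Fin N, bM N a s ν k ≤ SB d a := sum_bM_le hN a ha hs ν₀ ν
  have hFe : ∑ k : Fin d → Fin N, be N a s k * bM N a s μ k ≤ SBe d a / N := sum_be_bM_le hN a ha hs ν₀ hν₀ μ
  have hGe : ∑ k : Fin d → Fin N, be N a s k * bM N a s ν k ≤ SBe d a / N := sum_be_bM_le hN a ha hs ν₀ hν₀ ν
  have hF0 : 0 ≤ ∑ k : Fin d → Fin N, bM N a s μ k := Finset.sum_nonneg fun k _ => bM_nonneg ha _ _ _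
  have hG0 : 0 ≤ ∑ k : Fin d → Fin N, bM N a s ν k := Finset.sum_nonneg fun k _ => bM_nonneg ha _ _ _
  have hFe0 : 0 ≤ ∑ k : Fin d → Fin N, be N a s k * bM N a s μ k :=
    Finset.sum_nonneg fun k _ => mul_nonneg (be_nonneg ha hs ν₀ hν₀ k) (bM_nonneg ha _ _ _)
  have hGe0 : 0 ≤ ∑ k : Fin d → Fin N, be N a s k * bM N a s ν k :=
    Finset.sum_nonneg fun k _ => mul_nonneg (be_nonneg ha hs ν₀ hν₀ k) (bM_nonneg ha _ _ _)
  have hρN : rhoB d * ((N : ℝ) ^ 2)⁻¹ ≤ rhoB d / N := mul_inv_sq_le_div hρ hN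
  have h := sum_sum_rate_le (Finset.univ : Finset (Fin d → Fin N)) Finset.univ
    (ρ := rhoB d * ((N : ℝ) ^ 2)⁻¹) (K := (4 * d + a) / a)
    (E := fun k k' => ‖rEnt N a μ ν s k k' - rEnt (R * N) a μ ν s (iota R k s) (iota R k' s)‖)
    (F := fun k => bM N a s μ k) (G := fun k' => bM N a s ν k') (ε := fun k => be N a s k)
    (ε' := fun k' => be N a s k')
    (fun k _ k' _ => (rEnt_rate_le hN hR a ha μ ν hs ν₀ hν₀ k k').trans_eq (by ring))
  refine h.trans ?_
  calc (4 * d + a) / a * (rhoB d * ((N : ℝ) ^ 2)⁻¹ * (∑ k : Fin d → Fin N, bM N a s μ k)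
            * (∑ k' : Fin d → Fin N, bM N a s ν k')
          + (∑ k : Fin d → Fin N, be N a s k * bM N a s μ k) * (∑ k' : Fin d → Fin N, bM N a s ν k')
          + (∑ k : Fin d → Fin N, bM N a s μ k) * ∑ k' : Fin d → Fin N, be N a s k' * bM N a s ν k')
      ≤ (4 * d + a) / a * (rhoB d / N * SB d a * SB d a + SBe d a / N * SB d a + SB d a * (SBe d a / N)) := by
        gcongr
    _ = CRr d a / N := by unfold CRr; field_simp; ring

/-- **rank-one block, the UNPAIRED level-`RN` rows:** `Σ_{k″ unpaired} Σ_{k‴} ‖rEnt^{(RN)}(k″,k‴)‖ ≤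
((4d+a)/a)·SBu·SB/N`. [cite: King1986, (4.23) p.672] [folklore] -/
theorem rBlock_unpaired_rows_le (hN : 1 ≤ N) (hR : 1 ≤ R) (a : ℝ) (ha : 0 < a) (μ ν : Fin d)
    {s : Fin d → ℝ} (hs : ∀ ν, |s ν| ≤ Real.pi) (ν₀ : Fin d) (hν₀ : s ν₀ ≠ 0) :
    ∑ k'' ∈ Finset.univ.filter (fun k'' => ∀ k : Fin d → Fin N, iota R k s ≠ k''),
        ∑ l : Fin d → Fin (R * N), ‖rEnt (R * N) a μ ν s k'' l‖
      ≤ (4 * d + a) / a * SBu d * SB d a / N := by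
  have hd : 0 < d := Fin.pos ν₀
  have hN0 : (0 : ℝ) < N := by exact_mod_cast hN
  have hRN : 1 ≤ R * N := one_le_RN hN hR
  have hc := cB_pos hRN a ha hs ν₀ hν₀
  obtain ⟨hc1, hc2⟩ := cB_le hRN a ha hs ν₀ hν₀
  obtain ⟨hSB, -, hSBu⟩ := b_consts_nonneg hd ha
  calc ∑ k'' ∈ Finset.univ.filter (fun k'' => ∀ k : Fin d → Fin N, iota R k s ≠ k''),
          ∑ l : Fin d → Fin (R * N), ‖rEnt (R * N) a μ ν s k'' l‖
      ≤ cB (R * N) a s * (∑ k'' ∈ Finset.univ.filter (fun k'' => ∀ k : Fin d → Fin N, iota R k s ≠ k''),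
            bM (R * N) a s μ k'') * ∑ l : Fin d → Fin (R * N), bM (R * N) a s ν l :=
        sum_sum_le_of_le_mul _ _
          (fun k _ k' _ => norm_rEnt_le hRN a ha μ ν hs ν₀ hν₀ k k')
    _ ≤ (4 * d + a) / a * (SBu d / N) * SB d a :=
        mul_le_mul (mul_le_mul (hc1.trans hc2) (sum_bM_unpaired_le hN hR a hs ν₀ μ)
            (Finset.sum_nonneg fun k _ => bM_nonneg ha _ _ _) (by positivity))
          (sum_bM_le hRN a ha hs ν₀ ν) (Finset.sum_nonneg fun k _ => bM_nonneg ha _ _ _) (by positivity)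
    _ = (4 * d + a) / a * SBu d * SB d a / N := by ring

/-- **rank-one block, the UNPAIRED level-`RN` columns:** `Σ_{k″} Σ_{k‴ unpaired} ‖rEnt^{(RN)}(k″,k‴)‖ ≤
((4d+a)/a)·SB·SBu/N`. [cite: King1986, (4.23) p.672] [folklore] -/
theorem rBlock_unpaired_cols_le (hN : 1 ≤ N) (hR : 1 ≤ R) (a : ℝ) (ha : 0 < a) (μ ν : Fin d)
    {s : Fin d → ℝ} (hs : ∀ ν, |s ν| ≤ Real.pi) (ν₀ : Fin d) (hν₀ : s ν₀ ≠ 0) :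
    ∑ l : Fin d → Fin (R * N),
        ∑ k'' ∈ Finset.univ.filter (fun k'' => ∀ k : Fin d → Fin N, iota R k s ≠ k''),
          ‖rEnt (R * N) a μ ν s l k''‖ ≤ (4 * d + a) / a * SB d a * SBu d / N := by
  have hd : 0 < d := Fin.pos ν₀
  have hN0 : (0 : ℝ) < N := by exact_mod_cast hN
  have hRN : 1 ≤ R * N := one_le_RN hN hR
  have hc := cB_pos hRN a ha hs ν₀ hν₀
  obtain ⟨hc1, hc2⟩ := cB_le hRN a ha hs ν₀ hν₀
  obtain ⟨hSB, -, hSBu⟩ := b_consts_nonneg hd ha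
  calc ∑ l : Fin d → Fin (R * N),
          ∑ k'' ∈ Finset.univ.filter (fun k'' => ∀ k : Fin d → Fin N, iota R k s ≠ k''),
            ‖rEnt (R * N) a μ ν s l k''‖
      ≤ cB (R * N) a s * (∑ l : Fin d → Fin (R * N), bM (R * N) a s μ l)
          * ∑ k'' ∈ Finset.univ.filter (fun k'' => ∀ k : Fin d → Fin N, iota R k s ≠ k''),
              bM (R * N) a s ν k'' :=
        sum_sum_le_of_le_mul _ _
          (fun k _ k' _ => norm_rEnt_le hRN a ha μ ν hs ν₀ hν₀ k k')
    _ ≤ (4 * d + a) / a * SB d a * (SBu d / N) :=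
        mul_le_mul (mul_le_mul (hc1.trans hc2) (sum_bM_le hRN a ha hs ν₀ μ)
            (Finset.sum_nonneg fun k _ => bM_nonneg ha _ _ _) (by positivity))
          (sum_bM_unpaired_le hN hR a hs ν₀ ν) (Finset.sum_nonneg fun k _ => bM_nonneg ha _ _ _)
          (by positivity)
    _ = (4 * d + a) / a * SB d a * SBu d / N := by ring

end RankOne

/-! ## §5 The free diagonal and the assembled finite-rank statements

The first term of (1.83), `U = 1`, is the diagonal alias multiplier `Δ^{(n)}(q_l)⁻¹`; it is NOT summable in
`l` (the free propagator is singular at the origin in position space), so it is rated PER MODE (= in the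
diagonal operator norm): paired modes at `π²/24·N⁻²` (`B5G183Rate.inv_DeltaXir_sub_abs`), unpaired modes
bounded by `1/(4N²)`; the mode `l = 0` is regrouped into `dZ` (1.87) (`B5G183Rate.dZ_rate'`). -/

section Diagonal

variable {N R : ℕ} [NeZero N] [NeZero R]

omit [NeZero N] [NeZero R] in
/-- **free diagonal, paired modes:** `|Δ^{(N)}(q_k)⁻¹ − Δ^{(RN)}(q_k)⁻¹| ≤ (π²/24)·N⁻²` for EVERY class `k`
of `(ℤ/N)^d` (sup over the paired modes; no alias sum). [cite: Balaban1984PropagatorsI, (1.83) p.31;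
King1986, (4.29) p.673] [folklore] -/
theorem diag_paired_rate (hN : 1 ≤ N) (hR : 1 ≤ R) {s : Fin d → ℝ} (hs : ∀ ν, |s ν| ≤ Real.pi) (ν₀ : Fin d)
    (hν₀ : s ν₀ ≠ 0) (k : Fin d → Fin N) :
    |(DeltaXir N 0 (symmAlias N k s))⁻¹ - (DeltaXir (R * N) 0 (symmAlias N k s))⁻¹|
      ≤ Real.pi ^ 2 / 24 * ((N : ℝ) ^ 2)⁻¹ := by
  have hr := isRep_symmAlias hN k hs
  exact inv_DeltaXir_sub_abs hN hR hr.zone (momSq_pos_of_rep hs ν₀ hν₀ hr.exists_int)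

omit [NeZero N] in
/-- **free diagonal, unpaired modes:** an unpaired level-`RN` class has `‖q″‖ ≥ πN`, hence
`Δ^{(RN)}(q″) ≥ (4/π²)‖q″‖² ≥ 4N²` and `0 < Δ^{(RN)}(q″)⁻¹ ≤ 1/(4N²)`. [cite: King1986, (4.23) p.672] [folklore] -/
theorem diag_unpaired_le (hN : 1 ≤ N) (hR : 1 ≤ R) {s : Fin d → ℝ} (hs : ∀ ν, |s ν| ≤ Real.pi)
    {k'' : Fin d → Fin (R * N)} (hu : ∀ k : Fin d → Fin N, iota R k s ≠ k'') :
    0 < (DeltaXir (R * N) 0 (symmAlias (R * N) k'' s))⁻¹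
      ∧ (DeltaXir (R * N) 0 (symmAlias (R * N) k'' s))⁻¹ ≤ ((4 : ℝ) * (N : ℝ) ^ 2)⁻¹ := by
  have hπ := Real.pi_pos
  have hN0 : (0 : ℝ) < N := by exact_mod_cast hN
  have hRN : 1 ≤ R * N := one_le_RN hN hR
  have hr := isRep_symmAlias hRN k'' hs
  have hfar : Real.pi * N ≤ ‖symmAlias (R * N) k'' s‖ := norm_ge_of_unpaired hN hs hu
  have h1 : 4 * (N : ℝ) ^ 2 ≤ DeltaXir (R * N) 0 (symmAlias (R * N) k'' s) := by
    refine le_trans ?_ (DeltaXir_ge_momSq hRN hr.zone)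
    have h2 : (Real.pi * N) ^ 2 ≤ momSq (symmAlias (R * N) k'' s) :=
      (pow_le_pow_left₀ (by positivity) hfar 2).trans (norm_sq_le_momSq _)
    calc 4 * (N : ℝ) ^ 2 = 4 / Real.pi ^ 2 * (Real.pi * N) ^ 2 := by field_simp
      _ ≤ 4 / Real.pi ^ 2 * momSq (symmAlias (R * N) k'' s) := by gcongr
  have h4 : (0 : ℝ) < 4 * (N : ℝ) ^ 2 := by positivity
  exact ⟨inv_pos.mpr (h4.trans_le h1), inv_anti₀ h4 h1⟩

end Diagonal

/-! ### the assembled statements (finite-rank part of (1.83), one fibre `p′ ≠ 0`, directions `μ, ν`) -/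

section Assembled

variable {N R : ℕ} [NeZero N] [NeZero R]

omit [NeZero R] in
/-- **uniform `ℓ¹` bound of the finite-rank part of `G = Δ_a⁻¹` (1.83) at U = 1** (x-block without its
`(0,0)` corner + rank-one block), uniformly in the lattice spacing `N` and the fibre `p′ ≠ 0`:
`Σ_{l′≠0}‖x(0,l′)‖ + Σ_{l≠0}Σ_{l′}‖x(l,l′)‖ + Σ_lΣ_{l′}‖r(l,l′)‖ ≤ (π²/(4γ₀))·SX + SX·KX + ((4d+a)/a)·SB²`.
[cite: Balaban1984PropagatorsI, (1.83) p.31, p.32] [folklore] -/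
theorem finiteRank_l1_le (hN : 1 ≤ N) (a : ℝ) (ha : 0 < a) (μ ν : Fin d) {s : Fin d → ℝ}
    (hs : ∀ ν, |s ν| ≤ Real.pi) (ν₀ : Fin d) (hν₀ : s ν₀ ≠ 0) :
    (∑ k' ∈ Finset.univ.erase (0 : Fin d → Fin N), ‖xEnt N a μ s 0 k'‖)
      + (∑ k ∈ Finset.univ.erase (0 : Fin d → Fin N), ∑ k' : Fin d → Fin N, ‖xEnt N a μ s k k'‖)
      + (∑ k : Fin d → Fin N, ∑ k' : Fin d → Fin N, ‖rEnt N a μ ν s k k'‖)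
      ≤ Real.pi ^ 2 / 4 / T4GaugeActionRate.gam0 d * SX d + SX d * KX d + (4 * d + a) / a * SB d a * SB d a :=
  add_le_add (add_le_add (xBlock_row0_le hN a ha μ hs ν₀ hν₀) (xBlock_rows_le hN a ha μ hs ν₀ hν₀))
    (rBlock_le hN a ha μ ν hs ν₀ hν₀)

/-- **η-RATE `O(1/N)` of the PAIRED alias double sums of the finite-rank part of (1.83) at U = 1**:
`Σ_{k′≠0}‖x^{(N)}(0,k′) − x^{(RN)}(0,ιk′)‖ + Σ_{k≠0}Σ_{k′}‖x^{(N)}(k,k′) − x^{(RN)}(ιk,ιk′)‖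
 + Σ_kΣ_{k′}‖r^{(N)}(k,k′) − r^{(RN)}(ιk,ιk′)‖ ≤ (CX0r + CXr + CRr)/N` — no loss of η-currency (`γ = 1`).
[cite: King1986, (4.19)–(4.24) p.672, (4.29)–(4.31) p.673; Balaban1984PropagatorsI, (1.83) p.31, p.32] [folklore] -/
theorem finiteRank_paired_rate (hN : 1 ≤ N) (hR : 1 ≤ R) (a : ℝ) (ha : 0 < a) (μ ν : Fin d)
    {s : Fin d → ℝ} (hs : ∀ ν, |s ν| ≤ Real.pi) (ν₀ : Fin d) (hν₀ : s ν₀ ≠ 0) :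
    (∑ k' ∈ Finset.univ.erase (0 : Fin d → Fin N),
        ‖xEnt N a μ s 0 k' - xEnt (R * N) a μ s (iota R 0 s) (iota R k' s)‖)
      + (∑ k ∈ Finset.univ.erase (0 : Fin d → Fin N), ∑ k' : Fin d → Fin N,
          ‖xEnt N a μ s k k' - xEnt (R * N) a μ s (iota R k s) (iota R k' s)‖)
      + (∑ k : Fin d → Fin N, ∑ k' : Fin d → Fin N,
          ‖rEnt N a μ ν s k k' - rEnt (R * N) a μ ν s (iota R k s) (iota R k' s)‖)
      ≤ (CX0r d + CXr d + CRr d a) / N := by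
  rw [add_div, add_div]
  exact add_le_add (add_le_add (xBlock_row0_rate hN hR a ha μ hs ν₀ hν₀) (xBlock_rows_rate hN hR a ha μ hs ν₀ hν₀))
    (rBlock_rate hN hR a ha μ ν hs ν₀ hν₀)

/-- **the UNPAIRED level-`RN` classes of the finite-rank part are `O(1/N)` in `ℓ¹`** (rows and columns of
both blocks). [cite: King1986, (4.23) p.672] [folklore] -/
theorem finiteRank_unpaired_le (hN : 1 ≤ N) (hR : 1 ≤ R) (a : ℝ) (ha : 0 < a) (μ ν : Fin d)
    {s : Fin d → ℝ} (hs : ∀ ν, |s ν| ≤ Real.pi) (ν₀ : Fin d) (hν₀ : s ν₀ ≠ 0) :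
    (∑ k'' ∈ Finset.univ.filter (fun k'' => ∀ k : Fin d → Fin N, iota R k s ≠ k''),
        ∑ l : Fin d → Fin (R * N), ‖xEnt (R * N) a μ s k'' l‖)
      + (∑ l : Fin d → Fin (R * N),
          ∑ k'' ∈ Finset.univ.filter (fun k'' => ∀ k : Fin d → Fin N, iota R k s ≠ k''),
            ‖xEnt (R * N) a μ s l k''‖)
      + (∑ k'' ∈ Finset.univ.filter (fun k'' => ∀ k : Fin d → Fin N, iota R k s ≠ k''),
          ∑ l : Fin d → Fin (R * N), ‖rEnt (R * N) a μ ν s k'' l‖)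
      + (∑ l : Fin d → Fin (R * N),
          ∑ k'' ∈ Finset.univ.filter (fun k'' => ∀ k : Fin d → Fin N, iota R k s ≠ k''),
            ‖rEnt (R * N) a μ ν s l k''‖)
      ≤ (2 * (SXu d * KX d) + 2 * ((4 * d + a) / a * SBu d * SB d a)) / N := by
  have h1 := xBlock_unpaired_rows_le hN hR a ha μ hs ν₀ hν₀
  have h2 := xBlock_unpaired_cols_le hN hR a ha μ hs ν₀ hν₀
  have h3 := rBlock_unpaired_rows_le hN hR a ha μ ν hs ν₀ hν₀
  have h4 := rBlock_unpaired_cols_le hN hR a ha μ ν hs ν₀ hν₀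
  have e : (2 * (SXu d * KX d) + 2 * ((4 * d + a) / a * SBu d * SB d a)) / N
      = SXu d * KX d / N + KX d * SXu d / N + ((4 * d + a) / a * SBu d * SB d a / N
        + (4 * d + a) / a * SB d a * SBu d / N) := by ring
  rw [e]
  linarith

end Assembled

end Literature.MathematicalPhysics.QuantumFieldTheory.Balaban1983to89.B5G183RateSum
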